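import Literature.Analysis.FluidPDE.IntermittentJets
import Literature.Analysis.FunctionSpaces.TorusInvLaplacianGradientLp
import HarnessLib

/-!
# Intermittent jets on `𝕋³`: size bounds (Buckmaster–Vicol 2019 survey, §7.4 (7.22)–(7.24))

Analysis/FluidPDE support file (everything proved; no named facts), sibling of `IntermittentJets`.
T. Buckmaster, V. Vicol, EMS Surv. Math. Sci. 6 (2019) = arXiv:1901.09023, §7.4, summarise the
bounds obeyed by the intermittent jets in (7.22)–(7.24): "`‖∇^N ∂ₜ^M ψ_(ξ)‖_{L^p} ≲
r_∥^{1/p-1/2} (r_⊥λ/r_∥)^N (r_⊥λμ/r_∥)^M`, `‖∇^N φ_(ξ)‖_{L^p} + ‖∇^N Φ_(ξ)‖_{L^p} ≲ r_⊥^{2/p-1}λ^N`,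
`‖∇^N∂ₜ^M W_(ξ)‖_{L^p} + … ≲ r_⊥^{2/p-1} r_∥^{1/p-1/2} λ^N (r_⊥λμ/r_∥)^M`", obtained "from simple
scaling arguments" and "Fubini to combine the estimates obeyed by `ψ_(ξ)` (which is a 1D function)
and `φ_(ξ)`, `Φ_(ξ)` (which are 2D functions)". This file PROVES the instances of these bounds that
the scheme of `Literature.Barriers.AnomalousDissipation.BuckmasterVicol2019_iterationFromLevel` uses,
in the tree's parametrisation (`Jet.Params`: transverse concentration `μ = r_⊥⁻¹` relative to the
cell, axial concentration `κ = r_∥⁻¹`, cell frequency `σ = r_⊥λ ∈ ℕ`, temporal frequency `ω`; on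
`𝕋³`, so that the pipe profile `ψ_x` has amplitude `∼ μ` and `‖ψ_x‖_{L^p} ∼ μ^{1-2/p}`):

* sup bounds: `|η| ≲ κ^{1/2}`, `|η'| ≲ κ^{3/2}`, `|η''| ≲ κ^{5/2}`, `|ψ̃| ≲ μ`, `|∂ψ̃| ≲ σμ²`,
  `|∂φ̃| ≲ σ⁻¹`, `|∂∂φ̃| ≲ μ`;
* `L¹`, `L²` and `L^p` (`1 ≤ p ≤ 2`) bounds of the products of one axial and one transverse factor
  that occur in `W`, `W^{(c)}`, `Om`, `∇W`, `∇W^{(c)}`, `∂ₜOm`, `η²ψ̃²`, `∇(η²ψ̃²)` — all EXACT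
  factorisations `∫ F(η) G(ψ̃) = (∫₀¹ F∘g_κ)(∫ G∘ψ_x)` (`IntermittentJets.integral_axial_transverse`)
  followed by the window scalings of `g_κ` (`IntermittentTimeProfiles`) and the concentration
  bounds `IsConc` of the Mikado tool-kit (`MikadoRescaled`);
* the oscillation potential: `‖∇Δ⁻¹(η²ψ̃² - 1)‖_{L¹} ≲ σ⁻¹` (the gain of one cell frequency, from
  `Δ⁻¹(G(σ•·)) = σ⁻²(Δ⁻¹G)(σ•·)` and the `L¹` bound of `∇Δ⁻¹`, `TorusInvLaplacianGradientLp`);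

all with ONE constant depending only on the bump `g` (`Jet.exists_bounds`, packaged in
`Jet.Bounds`).

## References

* T. Buckmaster, V. Vicol, EMS Surv. Math. Sci. 6 (2019) = arXiv:1901.09023, §7.4 (7.22)–(7.24),
  §7.5.4 (7.43), §7.6.2 (7.54)–(7.59). [`BuckmasterVicol2020`]
-/

noncomputable section

open MeasureTheory Set Function UnitAddTorus
open scoped ContDiff ENNReal NNReal

namespace Literature.Analysis.FluidPDE

namespace Jet

open FunctionSpaces FunctionSpaces.Torus Mikado NashGeometric Transverse

/-- Local notation: the three-torus index. -/
local notation "𝔡" => Fin 3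

/-! ## Window bounds for the axial profile -/

section Window

variable {J : Params} (h : J.Valid)
include h

omit h in
/-- `|g_κ| ≤ κ^{1/2} sup|g|`. [cite: BuckmasterVicol2020, §7.4 (7.22)] -/
theorem abs_prof_le {B : ℝ} (hB : ∀ s, |J.g s| ≤ B) (u : ℝ) : |prof J u| ≤ Real.sqrt J.κ * B :=
  Intermittent.abs_profile_le hB J.κ u

/-- `|(g_κ)'| ≤ κ κ^{1/2} sup|g'|`. [cite: BuckmasterVicol2020, §7.4 (7.22)] -/
theorem abs_deriv_prof_le {B : ℝ} (hB : ∀ s, |deriv J.g s| ≤ B) (u : ℝ) :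
    |deriv (prof J) u| ≤ J.κ * (Real.sqrt J.κ * B) := by
  have hκ0 : 0 ≤ J.κ := by linarith [h.hκ]
  rw [deriv_prof h]
  simp only
  rw [abs_mul, abs_of_nonneg hκ0]
  exact mul_le_mul_of_nonneg_left (Intermittent.abs_profile_le hB J.κ u) hκ0

/-- `(g_κ)'' = κ² (g'')_κ`. [folklore] -/
theorem deriv_deriv_prof : deriv (deriv (prof J)) = fun r => J.κ ^ 2 * Intermittent.profile J.κ (deriv (deriv J.g)) r := by
  rw [deriv_prof h]
  funext r
  have := (h.hg.deriv.hasDerivAt_profile h.hκ r).const_mul J.κ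
  rw [show (fun t => J.κ * Intermittent.profile J.κ (deriv J.g) t) = fun t => J.κ * Intermittent.profile J.κ (deriv J.g) t from rfl]
  rw [this.deriv]
  ring

/-- `|(g_κ)''| ≤ κ² κ^{1/2} sup|g''|`. [cite: BuckmasterVicol2020, §7.4 (7.22)] -/
theorem abs_deriv_deriv_prof_le {B : ℝ} (hB : ∀ s, |deriv (deriv J.g) s| ≤ B) (u : ℝ) :
    |deriv (deriv (prof J)) u| ≤ J.κ ^ 2 * (Real.sqrt J.κ * B) := by
  have hκ0 : 0 ≤ J.κ := by linarith [h.hκ]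
  rw [deriv_deriv_prof h]
  simp only
  rw [abs_mul, abs_of_nonneg (by positivity)]
  exact mul_le_mul_of_nonneg_left (Intermittent.abs_profile_le hB J.κ u) (by positivity)

/-- `∫₀¹ |g_κ| = κ^{-1/2} ∫₀¹|g|`. [cite: BuckmasterVicol2020, §7.4 (7.22)] -/
theorem intervalIntegral_abs_prof : ∫ u in (0 : ℝ)..1, |prof J u| = J.κ ^ (-(1 / 2 : ℝ)) * ∫ u in (0 : ℝ)..1, |J.g u| := by
  have := h.hg.intervalIntegral_abs_profile_rpow h.hκ (p := 1) one_pos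
  simp only [Real.rpow_one] at this
  rw [prof, this]
  norm_num

/-- `∫₀¹ g_κ² = 1`. [cite: BuckmasterVicol2020, §7.4 (7.14)] -/
theorem intervalIntegral_prof_sq : ∫ u in (0 : ℝ)..1, prof J u ^ 2 = 1 := by
  rw [prof, h.hg.intervalIntegral_profile_sq h.hκ, h.hg1]

/-- `∫₀¹ |(g_κ)'| = κ κ^{-1/2} ∫₀¹|g'|`. [cite: BuckmasterVicol2020, §7.4 (7.22)] -/
theorem intervalIntegral_abs_deriv_prof :
    ∫ u in (0 : ℝ)..1, |deriv (prof J) u| = J.κ * (J.κ ^ (-(1 / 2 : ℝ)) * ∫ u in (0 : ℝ)..1, |deriv J.g u|) := by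
  have hκ0 : 0 ≤ J.κ := by linarith [h.hκ]
  have := h.hg.deriv.intervalIntegral_abs_profile_rpow h.hκ (p := 1) one_pos
  simp only [Real.rpow_one] at this
  rw [deriv_prof h]
  simp only [abs_mul, abs_of_nonneg hκ0, intervalIntegral.integral_const_mul]
  rw [this]
  norm_num

/-- `∫₀¹ |(g_κ)''| = κ² κ^{-1/2} ∫₀¹|g''|`. [cite: BuckmasterVicol2020, §7.4 (7.22)] -/
theorem intervalIntegral_abs_deriv_deriv_prof :
    ∫ u in (0 : ℝ)..1, |deriv (deriv (prof J)) u| =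
      J.κ ^ 2 * (J.κ ^ (-(1 / 2 : ℝ)) * ∫ u in (0 : ℝ)..1, |deriv (deriv J.g) u|) := by
  have hκ0 : 0 ≤ J.κ := by linarith [h.hκ]
  have := h.hg.deriv.deriv.intervalIntegral_abs_profile_rpow h.hκ (p := 1) one_pos
  simp only [Real.rpow_one] at this
  rw [deriv_deriv_prof h]
  simp only [abs_mul, abs_of_nonneg (pow_nonneg hκ0 2), intervalIntegral.integral_const_mul]
  rw [this]
  norm_num

/-- General `p`: `∫₀¹ |(g_κ)'|^p ≤ (κ κ^{1/2} sup|g'|)^{p-1} ∫₀¹|(g_κ)'|` for `1 ≤ p`. [folklore] -/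
theorem intervalIntegral_abs_deriv_prof_rpow_le {B : ℝ} (hB0 : 0 ≤ B) (hB : ∀ s, |deriv J.g s| ≤ B) {p : ℝ} (hp : 1 ≤ p) :
    ∫ u in (0 : ℝ)..1, |deriv (prof J) u| ^ p ≤
      (J.κ * (Real.sqrt J.κ * B)) ^ (p - 1) * ∫ u in (0 : ℝ)..1, |deriv (prof J) u| := by
  have hκ0 : 0 ≤ J.κ := by linarith [h.hκ]
  set S : ℝ := J.κ * (Real.sqrt J.κ * B) with hS
  have hS0 : 0 ≤ S := by positivity
  have hpt : ∀ u, |deriv (prof J) u| ^ p ≤ S ^ (p - 1) * |deriv (prof J) u| := by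
    intro u
    have ha : 0 ≤ |deriv (prof J) u| := abs_nonneg _
    have hle : |deriv (prof J) u| ≤ S := abs_deriv_prof_le h hB u
    calc |deriv (prof J) u| ^ p = |deriv (prof J) u| ^ (p - 1) * |deriv (prof J) u| := by
          rw [← Real.rpow_add_one' ha (by linarith), sub_add_cancel]
      _ ≤ S ^ (p - 1) * |deriv (prof J) u| :=
          mul_le_mul_of_nonneg_right (Real.rpow_le_rpow ha hle (by linarith)) ha
  have hc : Continuous (deriv (prof J)) := (contDiff_deriv_prof h).continuous
  calc ∫ u in (0 : ℝ)..1, |deriv (prof J) u| ^ p ≤ ∫ u in (0 : ℝ)..1, S ^ (p - 1) * |deriv (prof J) u| := by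
        refine intervalIntegral.integral_mono_on zero_le_one ?_ ?_ fun u _ => hpt u
        · exact ((hc.abs.rpow_const fun _ => Or.inr (by linarith)).intervalIntegrable _ _)
        · exact ((continuous_const.mul hc.abs).intervalIntegrable _ _)
    _ = S ^ (p - 1) * ∫ u in (0 : ℝ)..1, |deriv (prof J) u| := intervalIntegral.integral_const_mul _ _

/-- General `p`: `∫₀¹ |g_κ|^p ≤ (κ^{1/2} sup|g|)^{p-1} ∫₀¹|g_κ|` for `1 ≤ p`. [folklore] -/
theorem intervalIntegral_abs_prof_rpow_le {B : ℝ} (hB0 : 0 ≤ B) (hB : ∀ s, |J.g s| ≤ B) {p : ℝ} (hp : 1 ≤ p) :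
    ∫ u in (0 : ℝ)..1, |prof J u| ^ p ≤ (Real.sqrt J.κ * B) ^ (p - 1) * ∫ u in (0 : ℝ)..1, |prof J u| := by
  set S : ℝ := Real.sqrt J.κ * B with hS
  have hS0 : 0 ≤ S := by positivity
  have hpt : ∀ u, |prof J u| ^ p ≤ S ^ (p - 1) * |prof J u| := by
    intro u
    have ha : 0 ≤ |prof J u| := abs_nonneg _
    have hle : |prof J u| ≤ S := abs_prof_le hB u
    calc |prof J u| ^ p = |prof J u| ^ (p - 1) * |prof J u| := by
          rw [← Real.rpow_add_one' ha (by linarith), sub_add_cancel]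
      _ ≤ S ^ (p - 1) * |prof J u| := mul_le_mul_of_nonneg_right (Real.rpow_le_rpow ha hle (by linarith)) ha
  have hc : Continuous (prof J) := (contDiff_prof h).continuous
  calc ∫ u in (0 : ℝ)..1, |prof J u| ^ p ≤ ∫ u in (0 : ℝ)..1, S ^ (p - 1) * |prof J u| := by
        refine intervalIntegral.integral_mono_on zero_le_one ?_ ?_ fun u _ => hpt u
        · exact ((hc.abs.rpow_const fun _ => Or.inr (by linarith)).intervalIntegrable _ _)
        · exact ((continuous_const.mul hc.abs).intervalIntegrable _ _)
    _ = S ^ (p - 1) * ∫ u in (0 : ℝ)..1, |prof J u| := intervalIntegral.integral_const_mul _ _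

end Window

/-! ## Pull-back witnesses for the transverse quantities -/

section Pull

variable {d : Type*} [Fintype d] [DecidableEq d]

/-- A function on `𝕋^d` is the pull-back along `L_x` of a continuous function on the transverse
torus. [folklore] -/
def IsPullOf (x : Index d) (Q : UnitAddTorus d → ℝ) : Prop :=
  ∃ G : UnitAddTorus (Slot x) → ℝ, Continuous G ∧ Q = (datum x).pull G

/-- `ψ_x` is a pull-back. [folklore] -/
theorem isPullOf_psi (x : Index d) {μ : ℝ} (hμ : 1 ≤ μ) : IsPullOf x (psi x μ) :=
  ⟨psiT (datum x).c μ, (isSmooth_psiT (datum x).c hμ).continuous, rfl⟩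

/-- Partial derivatives of smooth pull-backs are pull-backs. [folklore] -/
theorem IsPullOf.partialDeriv {x : Index d} {Q : UnitAddTorus d → ℝ}
    (hQ : ∃ G : UnitAddTorus (Slot x) → ℝ, IsSmooth G ∧ Q = (datum x).pull G) (l : d) :
    ∃ G : UnitAddTorus (Slot x) → ℝ, IsSmooth G ∧ Torus.partialDeriv l Q = (datum x).pull G := by
  obtain ⟨G, hG, rfl⟩ := hQ
  refine ⟨fun w => ∑ l', ((datum x).A l l' : ℝ) • Torus.partialDeriv l' G w, ?_, ?_⟩
  · exact ContDiff.sum fun l' _ => ((hG.partialDeriv l').smul ((datum x).A l l' : ℝ))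
  · exact partialDeriv_pull_eq_pull (datum x) (hG.isContDiff (by simp)) l

/-- Smooth pull-back witnesses give continuous ones. [folklore] -/
theorem isPullOf_of_smooth {x : Index d} {Q : UnitAddTorus d → ℝ}
    (hQ : ∃ G : UnitAddTorus (Slot x) → ℝ, IsSmooth G ∧ Q = (datum x).pull G) : IsPullOf x Q := by
  obtain ⟨G, hG, rfl⟩ := hQ
  exact ⟨G, hG.continuous, rfl⟩

/-- `∂ₗψ_x` is a pull-back. [folklore] -/
theorem isPullOf_partialDeriv_psi (x : Index d) {μ : ℝ} (hμ : 1 ≤ μ) (l : d) : IsPullOf x (Torus.partialDeriv l (psi x μ)) :=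
  isPullOf_of_smooth (IsPullOf.partialDeriv ⟨psiT (datum x).c μ, isSmooth_psiT (datum x).c hμ, rfl⟩ l)

/-- `∂ₗφ_x` is a pull-back. [folklore] -/
theorem isPullOf_partialDeriv_phi (x : Index d) {μ : ℝ} (hμ : 1 ≤ μ) (l : d) : IsPullOf x (Torus.partialDeriv l (phi x μ)) :=
  isPullOf_of_smooth (IsPullOf.partialDeriv ⟨phiT (datum x).c μ, isSmooth_phiT (datum x).c hμ, rfl⟩ l)

/-- `∂ᵢ∂ₗφ_x` is a pull-back. [folklore] -/
theorem isPullOf_partialDeriv_partialDeriv_phi (x : Index d) {μ : ℝ} (hμ : 1 ≤ μ) (i l : d) :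
    IsPullOf x (Torus.partialDeriv i (Torus.partialDeriv l (phi x μ))) :=
  isPullOf_of_smooth (IsPullOf.partialDeriv (IsPullOf.partialDeriv ⟨phiT (datum x).c μ, isSmooth_phiT (datum x).c hμ, rfl⟩ l) i)

end Pull

/-! ## The factorised integral of the jet data -/

section Factor

variable {d : Type*} [Fintype d] [DecidableEq d]
variable {J : Params} (s : Index d → UnitAddTorus d) (h : J.Valid)
include h

/-- **The rescaled factorisation**: for a one-periodic continuous `P`, continuous `F`, `Φ` and a
pull-back `Q`, `∫ F(P̃(χ_{σk_x} y + r)) Φ(Q(σ•y - σ•s_x)) dy = (∫₀¹ F∘P)(∫ Φ∘Q)`.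
[cite: BuckmasterVicol2020, §7.4] -/
theorem integral_factor (x : Index d) {P : ℝ → ℝ} (hP : Periodic P 1) (hPc : Continuous P) {F : ℝ → ℝ} (hF : Continuous F)
    {Q : UnitAddTorus d → ℝ} (hQ : IsPullOf x Q) {Φ : ℝ → ℝ} (hΦ : Continuous Φ) (r : ℝ) :
    ∫ y, F (axialFn hP (nvec J x) r y) * Φ (Q (J.σ • y - J.σ • s x)) = (∫ u in (0 : ℝ)..1, F (P u)) * ∫ z, Φ (Q z) := by
  obtain ⟨G, hG, rfl⟩ := hQ
  have e : (fun y => F (axialFn hP (nvec J x) r y) * Φ ((datum x).pull G (J.σ • y - J.σ • s x))) =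
      fun y => (fun z => F (axialFn hP (dir x) r z) * Φ ((datum x).pull G (z - J.σ • s x))) (J.σ • y) := by
    funext y
    simp only [axialFn_nsmul]
    rfl
  have hcont : Continuous fun z => F (axialFn hP (dir x) r z) * Φ ((datum x).pull G (z - J.σ • s x)) := by
    refine (hF.comp (isContDiff_axialFn hP (k := 0) (contDiff_zero.2 hPc) (dir x) r).continuous).mul ?_
    exact hΦ.comp ((hG.comp (datum x).continuous_hom).comp (continuous_id.sub continuous_const))
  rw [e, integral_comp_nsmul h.hσ hcont.aestronglyMeasurable]
  exact integral_axial_transverse x hP hPc hF (hΦ.comp hG) r (J.σ • s x)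

end Factor

/-! ## From `L^p` bounds in `ℝ≥0∞` to real integrals -/

section Convert

variable {d : Type*} [Fintype d]

/-- `‖f‖_{L^p} ≤ M` (as an `eLpNorm` bound) gives `∫ |f|^p ≤ M^p` for continuous `f`, `1 ≤ p`, `0 ≤ M`.
[folklore] -/
theorem integral_abs_rpow_le_of_eLpNorm_le {f : UnitAddTorus d → ℝ} (hf : Continuous f) {p : ℝ} (hp : 1 ≤ p)
    {M : ℝ} (hM : 0 ≤ M) (hle : eLpNorm f (ENNReal.ofReal p) volume ≤ ENNReal.ofReal M) :
    ∫ y, |f y| ^ p ≤ M ^ p := by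
  have hp0 : 0 < p := by linarith
  rw [eLpNorm_eq_ofReal_rpow_integral hf hp, ENNReal.ofReal_le_ofReal_iff hM] at hle
  have hI : 0 ≤ ∫ y, |f y| ^ p := integral_nonneg fun _ => Real.rpow_nonneg (abs_nonneg _) _
  calc ∫ y, |f y| ^ p = ((∫ y, |f y| ^ p) ^ (1 / p)) ^ p := by
        rw [← Real.rpow_mul hI, one_div_mul_cancel hp0.ne', Real.rpow_one]
    _ ≤ M ^ p := Real.rpow_le_rpow (Real.rpow_nonneg hI _) hle hp0.le

/-- The case `p = 1`: `∫ |f| ≤ M`. [folklore] -/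
theorem integral_abs_le_of_eLpNorm_le {f : UnitAddTorus d → ℝ} (hf : Continuous f)
    {M : ℝ} (hM : 0 ≤ M) (hle : eLpNorm f (ENNReal.ofReal 1) volume ≤ ENNReal.ofReal M) :
    ∫ y, |f y| ≤ M := by
  have := integral_abs_rpow_le_of_eLpNorm_le hf le_rfl hM hle
  simpa using this

/-- `∫ |f| ≤ K ∫ |g|` from the operator bound `‖f‖_{L¹} ≤ K ‖g‖_{L¹}` for continuous `f`, `g`. [folklore] -/
theorem integral_abs_le_of_eLpNorm_one_le {f g : UnitAddTorus d → ℝ} (hf : Continuous f) (hg : Continuous g) {K : ℝ≥0}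
    (hle : eLpNorm f 1 volume ≤ K * eLpNorm g 1 volume) : ∫ y, |f y| ≤ K * ∫ y, |g y| := by
  have h1 : eLpNorm f 1 volume = ENNReal.ofReal (∫ y, |f y|) := by
    have := eLpNorm_eq_ofReal_rpow_integral hf (p := 1) le_rfl
    simpa using this
  have h2 : eLpNorm g 1 volume = ENNReal.ofReal (∫ y, |g y|) := by
    have := eLpNorm_eq_ofReal_rpow_integral hg (p := 1) le_rfl
    simpa using this
  have hg0 : 0 ≤ ∫ y, |g y| := integral_nonneg fun _ => abs_nonneg _
  rw [h1, h2, show (K : ℝ≥0∞) = ENNReal.ofReal (K : ℝ) by simp, ← ENNReal.ofReal_mul K.coe_nonneg] at hle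
  rwa [ENNReal.ofReal_le_ofReal_iff (mul_nonneg K.coe_nonneg hg0)] at hle

end Convert

/-! ## The transverse and axial constants -/

section Constants

/-- **The transverse constant of a direction**: one `C ≥ 1` controlling the sup and `L^p`
(`1 ≤ p ≤ 2`) sizes of `ψ_x`, `∂ψ_x`, `∂φ_x`, `∂∂φ_x` at every concentration `μ ≥ 1` on `𝕋³`
(`|ψ_x| ≤ Cμ`, `∫|ψ_x|^p ≤ (Cμ^{1-2/p})^p`, `|∂ₗψ_x| ≤ Cμ²`, `∫|∂ₗψ_x|^p ≤ (Cμ^{2-2/p})^p`,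
`|∂ₗφ_x| ≤ C`, `∫|∂ₗφ_x|^p ≤ (Cμ^{-2/p})^p`, `|∂ᵢ∂ₗφ_x| ≤ Cμ`, `∫|∂ᵢ∂ₗφ_x|^p ≤ (Cμ^{1-2/p})^p`;
BV (7.23) with `r_⊥ = μ⁻¹`). [cite: BuckmasterVicol2020, §7.4 (7.23)] -/
theorem exists_transverse_const (x : Index 𝔡) : ∃ C : ℝ, 1 ≤ C ∧ ∀ μ : ℝ, 1 ≤ μ →
    (∀ y, |psi x μ y| ≤ C * μ) ∧
    (∀ l y, |Torus.partialDeriv l (psi x μ) y| ≤ C * μ ^ 2) ∧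
    (∀ l y, |Torus.partialDeriv l (phi x μ) y| ≤ C) ∧
    (∀ i l y, |Torus.partialDeriv i (Torus.partialDeriv l (phi x μ)) y| ≤ C * μ) ∧
    (∀ p : ℝ, 1 ≤ p → p ≤ 2 →
      (∫ y, |psi x μ y| ^ p ≤ (C * μ ^ (1 - 2 / p)) ^ p) ∧
      (∀ l, ∫ y, |Torus.partialDeriv l (psi x μ) y| ^ p ≤ (C * μ ^ (2 - 2 / p)) ^ p) ∧
      (∀ l, ∫ y, |Torus.partialDeriv l (phi x μ) y| ^ p ≤ (C * μ ^ (-(2 / p))) ^ p) ∧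
      (∀ i l, ∫ y, |Torus.partialDeriv i (Torus.partialDeriv l (phi x μ)) y| ^ p ≤ (C * μ ^ (1 - 2 / p)) ^ p)) := by
  have hcard : ((Fintype.card 𝔡 : ℝ) - 1) / 2 = 1 := by norm_num [Fintype.card_fin]
  have hcard' : ((Fintype.card 𝔡 : ℝ) - 1) = 2 := by norm_num [Fintype.card_fin]
  -- the four families
  have h1 := (isConc_psi (d := 𝔡) (x := x))
  have h2 := fun l => isConc_partialDeriv_psi (d := 𝔡) (x := x) l
  have h3 := fun l => isConc_partialDeriv_phi (d := 𝔡) (x := x) l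
  have h4 := fun i l => isConc_partialDeriv_partialDeriv_phi (d := 𝔡) (x := x) i l
  obtain ⟨C₁, hC₁0, hS₁⟩ := h1.exists_sup
  obtain ⟨D₁, hD₁0, hL₁⟩ := h1.exists_eLpNorm
  choose C₂ hC₂0 hS₂ using fun l => (h2 l).exists_sup
  choose D₂ hD₂0 hL₂ using fun l => (h2 l).exists_eLpNorm
  choose C₃ hC₃0 hS₃ using fun l => (h3 l).exists_sup
  choose D₃ hD₃0 hL₃ using fun l => (h3 l).exists_eLpNorm
  choose C₄ hC₄0 hS₄ using fun i l => (h4 i l).exists_sup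
  choose D₄ hD₄0 hL₄ using fun i l => (h4 i l).exists_eLpNorm
  set C : ℝ := 1 + C₁ + D₁ + ∑ l, (C₂ l + D₂ l + C₃ l + D₃ l) + ∑ i, ∑ l, (C₄ i l + D₄ i l) with hC
  have hsum2 : ∀ l, C₂ l + D₂ l + C₃ l + D₃ l ≤ ∑ l, (C₂ l + D₂ l + C₃ l + D₃ l) := fun l =>
    Finset.single_le_sum (f := fun l => C₂ l + D₂ l + C₃ l + D₃ l)
      (fun l' _ => by linarith [hC₂0 l', hD₂0 l', hC₃0 l', hD₃0 l']) (Finset.mem_univ l)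
  have hsum4 : ∀ i l, C₄ i l + D₄ i l ≤ ∑ i, ∑ l, (C₄ i l + D₄ i l) := fun i l =>
    calc C₄ i l + D₄ i l ≤ ∑ l', (C₄ i l' + D₄ i l') :=
          Finset.single_le_sum (f := fun l' => C₄ i l' + D₄ i l') (fun l' _ => by linarith [hC₄0 i l', hD₄0 i l']) (Finset.mem_univ l)
      _ ≤ ∑ i', ∑ l', (C₄ i' l' + D₄ i' l') :=
          Finset.single_le_sum (f := fun i' => ∑ l', (C₄ i' l' + D₄ i' l'))
            (fun i' _ => Finset.sum_nonneg fun l' _ => by linarith [hC₄0 i' l', hD₄0 i' l']) (Finset.mem_univ i)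
  have hS2n : 0 ≤ ∑ l, (C₂ l + D₂ l + C₃ l + D₃ l) :=
    Finset.sum_nonneg fun l' _ => by linarith [hC₂0 l', hD₂0 l', hC₃0 l', hD₃0 l']
  have hS4n : 0 ≤ ∑ i, ∑ l, (C₄ i l + D₄ i l) :=
    Finset.sum_nonneg fun i' _ => Finset.sum_nonneg fun l' _ => by linarith [hC₄0 i' l', hD₄0 i' l']
  have hC1 : 1 ≤ C := by rw [hC]; linarith
  have hC0 : 0 ≤ C := by linarith
  have leC₁ : C₁ ≤ C := by rw [hC]; linarith
  have leD₁ : D₁ ≤ C := by rw [hC]; linarith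
  have leC₂ : ∀ l, C₂ l ≤ C := fun l => by rw [hC]; linarith [hsum2 l, hD₂0 l, hC₃0 l, hD₃0 l]
  have leD₂ : ∀ l, D₂ l ≤ C := fun l => by rw [hC]; linarith [hsum2 l, hC₂0 l, hC₃0 l, hD₃0 l]
  have leC₃ : ∀ l, C₃ l ≤ C := fun l => by rw [hC]; linarith [hsum2 l, hC₂0 l, hD₂0 l, hD₃0 l]
  have leD₃ : ∀ l, D₃ l ≤ C := fun l => by rw [hC]; linarith [hsum2 l, hC₂0 l, hD₂0 l, hC₃0 l]
  have leC₄ : ∀ i l, C₄ i l ≤ C := fun i l => by rw [hC]; linarith [hsum4 i l, hD₄0 i l]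
  have leD₄ : ∀ i l, D₄ i l ≤ C := fun i l => by rw [hC]; linarith [hsum4 i l, hC₄0 i l]
  refine ⟨C, hC1, fun μ hμ => ⟨fun y => ?_, fun l y => ?_, fun l y => ?_, fun i l y => ?_, fun p hp hp2 => ⟨?_, fun l => ?_, fun l => ?_, fun i l => ?_⟩⟩⟩
  · have := hS₁ μ hμ y; rw [hcard, Real.rpow_one] at this
    exact this.trans (mul_le_mul_of_nonneg_right leC₁ (by linarith))
  · have := hS₂ l μ hμ y; rw [hcard, show (1 : ℝ) + 1 = 2 by norm_num, Real.rpow_two] at this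
    exact this.trans (mul_le_mul_of_nonneg_right (leC₂ l) (by positivity))
  · have := hS₃ l μ hμ y; rw [hcard, sub_self, Real.rpow_zero, mul_one] at this
    exact this.trans (leC₃ l)
  · have := hS₄ i l μ hμ y; rw [hcard, Real.rpow_one] at this
    exact this.trans (mul_le_mul_of_nonneg_right (leC₄ i l) (by linarith))
  · have hle := hL₁ μ hμ p hp hp2
    rw [hcard, hcard'] at hle
    have hM : 0 ≤ D₁ * μ ^ (1 - 2 / p) := mul_nonneg hD₁0 (Real.rpow_nonneg (by linarith) _)
    refine (integral_abs_rpow_le_of_eLpNorm_le (h1.continuous hμ) hp hM hle).trans ?_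
    exact Real.rpow_le_rpow hM (mul_le_mul_of_nonneg_right leD₁ (Real.rpow_nonneg (by linarith) _)) (by linarith)
  · have hle := hL₂ l μ hμ p hp hp2
    rw [hcard, hcard', show (1 : ℝ) + 1 - 2 / p = 2 - 2 / p by ring] at hle
    have hM : 0 ≤ D₂ l * μ ^ (2 - 2 / p) := mul_nonneg (hD₂0 l) (Real.rpow_nonneg (by linarith) _)
    refine (integral_abs_rpow_le_of_eLpNorm_le ((h2 l).continuous hμ) hp hM hle).trans ?_
    exact Real.rpow_le_rpow hM (mul_le_mul_of_nonneg_right (leD₂ l) (Real.rpow_nonneg (by linarith) _)) (by linarith)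
  · have hle := hL₃ l μ hμ p hp hp2
    rw [hcard, hcard', show (1 : ℝ) - 1 - 2 / p = -(2 / p) by ring] at hle
    have hM : 0 ≤ D₃ l * μ ^ (-(2 / p)) := mul_nonneg (hD₃0 l) (Real.rpow_nonneg (by linarith) _)
    refine (integral_abs_rpow_le_of_eLpNorm_le ((h3 l).continuous hμ) hp hM hle).trans ?_
    exact Real.rpow_le_rpow hM (mul_le_mul_of_nonneg_right (leD₃ l) (Real.rpow_nonneg (by linarith) _)) (by linarith)
  · have hle := hL₄ i l μ hμ p hp hp2
    rw [hcard, hcard'] at hle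
    have hM : 0 ≤ D₄ i l * μ ^ (1 - 2 / p) := mul_nonneg (hD₄0 i l) (Real.rpow_nonneg (by linarith) _)
    refine (integral_abs_rpow_le_of_eLpNorm_le ((h4 i l).continuous hμ) hp hM hle).trans ?_
    exact Real.rpow_le_rpow hM (mul_le_mul_of_nonneg_right (leD₄ i l) (Real.rpow_nonneg (by linarith) _)) (by linarith)

/-- **The axial constant of a bump**: one `A ≥ 1` with `|g|, |g'|, |g''| ≤ A` and
`∫₀¹|g|, ∫₀¹|g'|, ∫₀¹|g''| ≤ A`. [folklore] -/
theorem exists_axial_const {g : ℝ → ℝ} (hg : Intermittent.IsBump g) : ∃ A : ℝ, 1 ≤ A ∧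
    (∀ s, |g s| ≤ A) ∧ (∀ s, |deriv g s| ≤ A) ∧ (∀ s, |deriv (deriv g) s| ≤ A) ∧
    (∫ u in (0 : ℝ)..1, |g u|) ≤ A ∧ (∫ u in (0 : ℝ)..1, |deriv g u|) ≤ A ∧ (∫ u in (0 : ℝ)..1, |deriv (deriv g) u|) ≤ A := by
  obtain ⟨B₀, hB₀0, hB₀⟩ := hg.exists_bound
  obtain ⟨B₁, hB₁0, hB₁⟩ := hg.deriv.exists_bound
  obtain ⟨B₂, hB₂0, hB₂⟩ := hg.deriv.deriv.exists_bound
  have hint : ∀ {f : ℝ → ℝ} {B : ℝ}, Continuous f → (∀ s, |f s| ≤ B) → (∫ u in (0 : ℝ)..1, |f u|) ≤ B := by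
    intro f B hf hB
    calc (∫ u in (0 : ℝ)..1, |f u|) ≤ ∫ _ in (0 : ℝ)..1, B :=
          intervalIntegral.integral_mono_on zero_le_one (hf.abs.intervalIntegrable _ _) intervalIntegrable_const
            fun u _ => hB u
      _ = B := by simp
  refine ⟨1 + B₀ + B₁ + B₂, by linarith, fun s => (hB₀ s).trans (by linarith), fun s => (hB₁ s).trans (by linarith),
    fun s => (hB₂ s).trans (by linarith), (hint hg.continuous hB₀).trans (by linarith),
    (hint hg.deriv.continuous hB₁).trans (by linarith), (hint hg.deriv.deriv.continuous hB₂).trans (by linarith)⟩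

end Constants

/-! ## The jet quantities in rescaled form -/

section Rescaled

variable {J : Params} (s : Index 𝔡 → UnitAddTorus 𝔡) (h : J.Valid)
include h

omit h in
/-- `ψ̃_x(y) = ψ_x(σ•y - σ•s_x)`. [folklore] -/
theorem psiJ_eq (x : Index 𝔡) (y : UnitAddTorus 𝔡) : psiJ J s x y = psi x J.μ (J.σ • y - J.σ • s x) := by
  simp [psiJ, psiR, smul_sub]

omit h in
/-- `∂ₗψ̃_x(y) = σ (∂ₗψ_x)(σ•y - σ•s_x)`. [folklore] -/
theorem partialDeriv_psiJ_eq (x : Index 𝔡) (l : 𝔡) (y : UnitAddTorus 𝔡) :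
    Torus.partialDeriv l (psiJ J s x) y = (J.σ : ℝ) * Torus.partialDeriv l (psi x J.μ) (J.σ • y - J.σ • s x) := by
  show Torus.partialDeriv l (fun y => psiR x J.μ J.σ (y - s x)) y = _
  rw [partialDeriv_comp_sub]
  simp only
  rw [partialDeriv_psiR, smul_sub]

/-- `∂ₗφ̃_x(y) = σ⁻¹ (∂ₗφ_x)(σ•y - σ•s_x)`. [folklore] -/
theorem partialDeriv_phiJ_eq (x : Index 𝔡) (l : 𝔡) (y : UnitAddTorus 𝔡) :
    Torus.partialDeriv l (phiJ J s x) y = ((J.σ : ℝ))⁻¹ * Torus.partialDeriv l (phi x J.μ) (J.σ • y - J.σ • s x) := by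
  rw [partialDeriv_phiJ s x l y, partialDeriv_phiR x h.hμ h.hσ, smul_sub]

/-- `∂ᵢ∂ₗφ̃_x(y) = (∂ᵢ∂ₗφ_x)(σ•y - σ•s_x)`. [folklore] -/
theorem partialDeriv_partialDeriv_phiJ_eq (x : Index 𝔡) (i l : 𝔡) (y : UnitAddTorus 𝔡) :
    Torus.partialDeriv i (Torus.partialDeriv l (phiJ J s x)) y =
      Torus.partialDeriv i (Torus.partialDeriv l (phi x J.μ)) (J.σ • y - J.σ • s x) := by
  have e : Torus.partialDeriv l (phiJ J s x) = fun y => Torus.partialDeriv l (phiR x J.μ J.σ) (y - s x) :=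
    funext (partialDeriv_phiJ s x l)
  rw [e, partialDeriv_comp_sub]
  simp only
  rw [partialDeriv_partialDeriv_phiR x h.hμ h.hσ, smul_sub]

end Rescaled

/-- Nonnegativity of window integrals of absolute values. [folklore] -/
theorem intervalIntegral_abs_nonneg (f : ℝ → ℝ) : 0 ≤ ∫ u in (0 : ℝ)..1, |f u| :=
  intervalIntegral.integral_nonneg zero_le_one fun _ _ => abs_nonneg _

/-! ## The bounds, one by one -/

section Bounds

variable {J : Params} (s : Index 𝔡 → UnitAddTorus 𝔡) (h : J.Valid)
include h

/-- Shorthand hypotheses: `A` is an axial constant for `J.g`, `C` a transverse constant for `x`. [folklore] -/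
structure ConstData (J : Params) (x : Index 𝔡) (A C : ℝ) : Prop where
  hA1 : 1 ≤ A
  hg : ∀ s, |J.g s| ≤ A
  hg' : ∀ s, |deriv J.g s| ≤ A
  hg'' : ∀ s, |deriv (deriv J.g) s| ≤ A
  hIg : (∫ u in (0 : ℝ)..1, |J.g u|) ≤ A
  hIg' : (∫ u in (0 : ℝ)..1, |deriv J.g u|) ≤ A
  hIg'' : (∫ u in (0 : ℝ)..1, |deriv (deriv J.g) u|) ≤ A
  hC1 : 1 ≤ C
  hpsi : ∀ μ : ℝ, 1 ≤ μ → ∀ y, |psi x μ y| ≤ C * μ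
  hdpsi : ∀ μ : ℝ, 1 ≤ μ → ∀ l y, |Torus.partialDeriv l (psi x μ) y| ≤ C * μ ^ 2
  hdphi : ∀ μ : ℝ, 1 ≤ μ → ∀ l y, |Torus.partialDeriv l (phi x μ) y| ≤ C
  hddphi : ∀ μ : ℝ, 1 ≤ μ → ∀ i l y, |Torus.partialDeriv i (Torus.partialDeriv l (phi x μ)) y| ≤ C * μ
  hLpsi : ∀ μ : ℝ, 1 ≤ μ → ∀ p : ℝ, 1 ≤ p → p ≤ 2 → ∫ y, |psi x μ y| ^ p ≤ (C * μ ^ (1 - 2 / p)) ^ p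
  hLdpsi : ∀ μ : ℝ, 1 ≤ μ → ∀ p : ℝ, 1 ≤ p → p ≤ 2 → ∀ l, ∫ y, |Torus.partialDeriv l (psi x μ) y| ^ p ≤ (C * μ ^ (2 - 2 / p)) ^ p
  hLdphi : ∀ μ : ℝ, 1 ≤ μ → ∀ p : ℝ, 1 ≤ p → p ≤ 2 → ∀ l, ∫ y, |Torus.partialDeriv l (phi x μ) y| ^ p ≤ (C * μ ^ (-(2 / p))) ^ p
  hLddphi : ∀ μ : ℝ, 1 ≤ μ → ∀ p : ℝ, 1 ≤ p → p ≤ 2 → ∀ i l,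
    ∫ y, |Torus.partialDeriv i (Torus.partialDeriv l (phi x μ)) y| ^ p ≤ (C * μ ^ (1 - 2 / p)) ^ p

variable {x : Index 𝔡} {A C : ℝ} (hc : ConstData J x A C)
include hc

/-! ### Sup bounds -/

omit h in
/-- `|η_x| ≤ A κ^{1/2}`. [cite: BuckmasterVicol2020, §7.4 (7.22)] -/
theorem abs_eta_le (t : ℝ) (y : UnitAddTorus 𝔡) : |eta J x t y| ≤ A * J.κ ^ (1 / 2 : ℝ) := by
  have := abs_axialFn_le (prof_periodic J) (abs_prof_le hc.hg) (nvec J x) (J.om * t) y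
  rw [Real.sqrt_eq_rpow] at this
  simpa [eta, mul_comm] using this

/-- `|η'_x| ≤ A κ^{3/2}`. [cite: BuckmasterVicol2020, §7.4 (7.22)] -/
theorem abs_etaD_le (t : ℝ) (y : UnitAddTorus 𝔡) : |etaD J x t y| ≤ A * J.κ ^ (3 / 2 : ℝ) := by
  have hκ0 : 0 ≤ J.κ := by linarith [h.hκ]
  have := abs_axialFn_le (periodic_deriv (prof_periodic J)) (abs_deriv_prof_le h hc.hg') (nvec J x) (J.om * t) y
  have e : J.κ * (Real.sqrt J.κ * A) = A * J.κ ^ (3 / 2 : ℝ) := by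
    rw [Real.sqrt_eq_rpow, show (3 / 2 : ℝ) = 1 + 1 / 2 by norm_num, Real.rpow_add_of_nonneg hκ0 (by norm_num) (by norm_num),
      Real.rpow_one]; ring
  rw [e] at this
  simpa [etaD] using this

/-- `|η''_x| ≤ A κ^{5/2}`. [cite: BuckmasterVicol2020, §7.4 (7.22)] -/
theorem abs_etaDD_le (t : ℝ) (y : UnitAddTorus 𝔡) : |etaDD J x t y| ≤ A * J.κ ^ (5 / 2 : ℝ) := by
  have hκ0 : 0 ≤ J.κ := by linarith [h.hκ]
  have := abs_axialFn_le (periodic_deriv (periodic_deriv (prof_periodic J))) (abs_deriv_deriv_prof_le h hc.hg'')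
    (nvec J x) (J.om * t) y
  have e : J.κ ^ 2 * (Real.sqrt J.κ * A) = A * J.κ ^ (5 / 2 : ℝ) := by
    rw [Real.sqrt_eq_rpow, show (5 / 2 : ℝ) = 2 + 1 / 2 by norm_num, Real.rpow_add_of_nonneg hκ0 (by norm_num) (by norm_num),
      Real.rpow_two]; ring
  rw [e] at this
  simpa [etaDD] using this

/-- `|ψ̃_x| ≤ C μ`. [cite: BuckmasterVicol2020, §7.4 (7.23)] -/
theorem abs_psiJ_le (y : UnitAddTorus 𝔡) : |psiJ J s x y| ≤ C * J.μ := by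
  rw [psiJ_eq s x y]; exact hc.hpsi J.μ h.hμ _

/-- `|∂ₗψ̃_x| ≤ C σ μ²`. [cite: BuckmasterVicol2020, §7.4 (7.23)] -/
theorem abs_partialDeriv_psiJ_le (l : 𝔡) (y : UnitAddTorus 𝔡) :
    |Torus.partialDeriv l (psiJ J s x) y| ≤ C * J.σ * J.μ ^ 2 := by
  have hσ0 : (0 : ℝ) ≤ J.σ := Nat.cast_nonneg _
  rw [partialDeriv_psiJ_eq s x l y, abs_mul, abs_of_nonneg hσ0]
  calc (J.σ : ℝ) * |Torus.partialDeriv l (psi x J.μ) (J.σ • y - J.σ • s x)| ≤ J.σ * (C * J.μ ^ 2) :=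
        mul_le_mul_of_nonneg_left (hc.hdpsi J.μ h.hμ l _) hσ0
    _ = C * J.σ * J.μ ^ 2 := by ring

/-- `|∂ₗφ̃_x| ≤ C σ⁻¹`. [cite: BuckmasterVicol2020, §7.4 (7.23)] -/
theorem abs_partialDeriv_phiJ_le (l : 𝔡) (y : UnitAddTorus 𝔡) :
    |Torus.partialDeriv l (phiJ J s x) y| ≤ C * ((J.σ : ℝ))⁻¹ := by
  have hσ0 : (0 : ℝ) ≤ ((J.σ : ℝ))⁻¹ := inv_nonneg.2 (Nat.cast_nonneg _)
  rw [partialDeriv_phiJ_eq s h x l y, abs_mul, abs_of_nonneg hσ0]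
  calc ((J.σ : ℝ))⁻¹ * |Torus.partialDeriv l (phi x J.μ) (J.σ • y - J.σ • s x)| ≤ ((J.σ : ℝ))⁻¹ * C :=
        mul_le_mul_of_nonneg_left (hc.hdphi J.μ h.hμ l _) hσ0
    _ = C * ((J.σ : ℝ))⁻¹ := by ring

/-- `|∂ᵢ∂ₗφ̃_x| ≤ C μ`. [cite: BuckmasterVicol2020, §7.4 (7.23)] -/
theorem abs_partialDeriv_partialDeriv_phiJ_le (i l : 𝔡) (y : UnitAddTorus 𝔡) :
    |Torus.partialDeriv i (Torus.partialDeriv l (phiJ J s x)) y| ≤ C * J.μ := by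
  rw [partialDeriv_partialDeriv_phiJ_eq s h x i l y]; exact hc.hddphi J.μ h.hμ i l _

/-! ### The factorised `L¹` bounds -/

omit hc in
/-- Generic `L¹` product bound: from `∫₀¹ |F∘P| ≤ a`, `∫ |Φ∘Q| ≤ b` and the exact factorisation,
`∫ |F(axial)| |Φ(Q(σ•y - σ•s))| ≤ a b`. [folklore] -/
theorem integral_abs_mul_abs_le {P : ℝ → ℝ} (hP : Periodic P 1) (hPc : Continuous P) {F : ℝ → ℝ} (hF : Continuous F)
    {Q : UnitAddTorus 𝔡 → ℝ} (hQ : IsPullOf x Q) {Φ : ℝ → ℝ} (hΦ : Continuous Φ) (r : ℝ) {a b : ℝ}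
    (ha : ∫ u in (0 : ℝ)..1, |F (P u)| ≤ a) (hb : ∫ z, |Φ (Q z)| ≤ b) (hb0 : 0 ≤ ∫ u in (0 : ℝ)..1, |F (P u)|) :
    ∫ y, |F (axialFn hP (nvec J x) r y)| * |Φ (Q (J.σ • y - J.σ • s x))| ≤ a * b := by
  rw [integral_factor s h x hP hPc (F := fun v => |F v|) hF.abs hQ (Φ := fun v => |Φ v|) hΦ.abs r]
  have hb' : 0 ≤ ∫ z, |Φ (Q z)| := integral_nonneg fun _ => abs_nonneg _
  exact mul_le_mul ha hb hb' (hb0.trans ha)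

/-- `∫ |η_x| |ψ̃_x| ≤ A C κ^{-1/2} μ⁻¹` (BV (7.24), `N = M = 0`, `p = 1`). [cite: BuckmasterVicol2020, §7.4 (7.24)] -/
theorem integral_eta_psi_le (t : ℝ) : ∫ y, |eta J x t y| * |psiJ J s x y| ≤ A * C * J.κ ^ (-(1 / 2 : ℝ)) * J.μ⁻¹ := by
  have hκ0 : 0 ≤ J.κ := by linarith [h.hκ]
  have hμ0 : 0 < J.μ := by linarith [h.hμ]
  have ha : ∫ u in (0 : ℝ)..1, |(fun v => v) (prof J u)| ≤ J.κ ^ (-(1 / 2 : ℝ)) * A := by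
    simp only
    rw [intervalIntegral_abs_prof h]
    exact mul_le_mul_of_nonneg_left hc.hIg (Real.rpow_nonneg hκ0 _)
  have hb : ∫ z, |(fun v => v) (psi x J.μ z)| ≤ C * J.μ⁻¹ := by
    have := hc.hLpsi J.μ h.hμ 1 le_rfl (by norm_num)
    rw [show (1 : ℝ) - 2 / 1 = -1 by norm_num, Real.rpow_neg_one] at this
    simpa using this
  have := integral_abs_mul_abs_le s h (prof_periodic J) (contDiff_prof h).continuous continuous_id (isPullOf_psi x h.hμ)
    continuous_id (J.om * t) ha hb (intervalIntegral_abs_nonneg _)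
  simp only [id] at this
  calc ∫ y, |eta J x t y| * |psiJ J s x y| = ∫ y, |axialFn (prof_periodic J) (nvec J x) (J.om * t) y| * |psi x J.μ (J.σ • y - J.σ • s x)| := by
        simp only [eta, psiJ_eq s x]
    _ ≤ J.κ ^ (-(1 / 2 : ℝ)) * A * (C * J.μ⁻¹) := this
    _ = A * C * J.κ ^ (-(1 / 2 : ℝ)) * J.μ⁻¹ := by ring

/-! ### More `L¹` bounds -/

omit h hc in
/-- Products of pull-backs are pull-backs. [folklore] -/
theorem IsPullOf.mul {Q₁ Q₂ : UnitAddTorus 𝔡 → ℝ} (h₁ : IsPullOf x Q₁) (h₂ : IsPullOf x Q₂) :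
    IsPullOf x (fun z => Q₁ z * Q₂ z) := by
  obtain ⟨G₁, hG₁, rfl⟩ := h₁
  obtain ⟨G₂, hG₂, rfl⟩ := h₂
  exact ⟨fun w => G₁ w * G₂ w, hG₁.mul hG₂, rfl⟩

omit h hc in
/-- The axial function of a product of periodic functions. [folklore] -/
theorem axialFn_mul {P Q : ℝ → ℝ} (hP : Periodic P 1) (hQ : Periodic Q 1) (n : 𝔡 → ℤ) (r : ℝ) (y : UnitAddTorus 𝔡) :
    axialFn (hP.mul hQ) n r y = axialFn hP n r y * axialFn hQ n r y := by
  obtain ⟨Y, rfl⟩ := proj_surjective y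
  simp only [axialFn_proj, Pi.mul_apply]

/-- `∫ |η'_x| |ψ̃_x| ≤ A C κ^{1/2} μ⁻¹`. [cite: BuckmasterVicol2020, §7.4 (7.24)] -/
theorem integral_etaD_psi_le (t : ℝ) : ∫ y, |etaD J x t y| * |psiJ J s x y| ≤ A * C * J.κ ^ (1 / 2 : ℝ) * J.μ⁻¹ := by
  have hκ0 : 0 < J.κ := by linarith [h.hκ]
  have ha : ∫ u in (0 : ℝ)..1, |(fun v => v) (deriv (prof J) u)| ≤ J.κ ^ (1 / 2 : ℝ) * A := by
    simp only
    rw [intervalIntegral_abs_deriv_prof h, ← mul_assoc, show J.κ * J.κ ^ (-(1 / 2 : ℝ)) = J.κ ^ (1 / 2 : ℝ) by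
      rw [show J.κ * J.κ ^ (-(1 / 2 : ℝ)) = J.κ ^ (1 : ℝ) * J.κ ^ (-(1 / 2 : ℝ)) by rw [Real.rpow_one],
        ← Real.rpow_add hκ0]; norm_num]
    exact mul_le_mul_of_nonneg_left hc.hIg' (Real.rpow_nonneg hκ0.le _)
  have hb : ∫ z, |(fun v => v) (psi x J.μ z)| ≤ C * J.μ⁻¹ := by
    have := hc.hLpsi J.μ h.hμ 1 le_rfl (by norm_num)
    rw [show (1 : ℝ) - 2 / 1 = -1 by norm_num, Real.rpow_neg_one] at this
    simpa using this
  have := integral_abs_mul_abs_le s h (periodic_deriv (prof_periodic J)) (contDiff_deriv_prof h).continuous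
    continuous_id (isPullOf_psi x h.hμ) continuous_id (J.om * t) ha hb (intervalIntegral_abs_nonneg _)
  calc ∫ y, |etaD J x t y| * |psiJ J s x y|
      = ∫ y, |axialFn (periodic_deriv (prof_periodic J)) (nvec J x) (J.om * t) y| * |psi x J.μ (J.σ • y - J.σ • s x)| := by
        simp only [etaD, psiJ_eq s x]
    _ ≤ J.κ ^ (1 / 2 : ℝ) * A * (C * J.μ⁻¹) := this
    _ = A * C * J.κ ^ (1 / 2 : ℝ) * J.μ⁻¹ := by ring

/-- `∫ |η_x| |∂ₗψ̃_x| ≤ A C σ κ^{-1/2}`. [cite: BuckmasterVicol2020, §7.4 (7.24)] -/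
theorem integral_eta_partialDeriv_psiJ_le (t : ℝ) (l : 𝔡) :
    ∫ y, |eta J x t y| * |Torus.partialDeriv l (psiJ J s x) y| ≤ A * C * J.σ * J.κ ^ (-(1 / 2 : ℝ)) := by
  have hκ0 : 0 ≤ J.κ := by linarith [h.hκ]
  have hσ0 : (0 : ℝ) ≤ J.σ := Nat.cast_nonneg _
  have ha : ∫ u in (0 : ℝ)..1, |(fun v => v) (prof J u)| ≤ J.κ ^ (-(1 / 2 : ℝ)) * A := by
    simp only
    rw [intervalIntegral_abs_prof h]
    exact mul_le_mul_of_nonneg_left hc.hIg (Real.rpow_nonneg hκ0 _)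
  have hb : ∫ z, |(fun v => v) (Torus.partialDeriv l (psi x J.μ) z)| ≤ C := by
    have := hc.hLdpsi J.μ h.hμ 1 le_rfl (by norm_num) l
    rw [show (2 : ℝ) - 2 / 1 = 0 by norm_num, Real.rpow_zero] at this
    simpa using this
  have := integral_abs_mul_abs_le s h (prof_periodic J) (contDiff_prof h).continuous
    continuous_id (isPullOf_partialDeriv_psi x h.hμ l) continuous_id (J.om * t) ha hb (intervalIntegral_abs_nonneg _)
  calc ∫ y, |eta J x t y| * |Torus.partialDeriv l (psiJ J s x) y|
      = ∫ y, (J.σ : ℝ) * (|axialFn (prof_periodic J) (nvec J x) (J.om * t) y| *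
          |Torus.partialDeriv l (psi x J.μ) (J.σ • y - J.σ • s x)|) := by
        refine integral_congr_ae (ae_of_all _ fun y => ?_)
        simp only [eta, partialDeriv_psiJ_eq s x l y, abs_mul, abs_of_nonneg hσ0]
        ring
    _ = (J.σ : ℝ) * ∫ y, |axialFn (prof_periodic J) (nvec J x) (J.om * t) y| *
          |Torus.partialDeriv l (psi x J.μ) (J.σ • y - J.σ • s x)| := integral_const_mul _ _
    _ ≤ (J.σ : ℝ) * (J.κ ^ (-(1 / 2 : ℝ)) * A * C) := mul_le_mul_of_nonneg_left this hσ0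
    _ = A * C * J.σ * J.κ ^ (-(1 / 2 : ℝ)) := by ring

/-- The transverse `L¹` size of `∂ₗφ_x`: `∫ |∂ₗφ_x| ≤ C μ⁻²`. [folklore] -/
theorem integral_abs_partialDeriv_phi_le (l : 𝔡) : ∫ z, |Torus.partialDeriv l (phi x J.μ) z| ≤ C * J.μ ^ (-(2 : ℝ)) := by
  have := hc.hLdphi J.μ h.hμ 1 le_rfl (by norm_num) l
  rw [show -((2 : ℝ) / 1) = -2 by norm_num] at this
  simpa using this

/-- The transverse `L¹` size of `∂ᵢ∂ₗφ_x`: `∫ |∂ᵢ∂ₗφ_x| ≤ C μ⁻¹`. [folklore] -/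
theorem integral_abs_partialDeriv_partialDeriv_phi_le (i l : 𝔡) :
    ∫ z, |Torus.partialDeriv i (Torus.partialDeriv l (phi x J.μ)) z| ≤ C * J.μ⁻¹ := by
  have := hc.hLddphi J.μ h.hμ 1 le_rfl (by norm_num) i l
  rw [show (1 : ℝ) - 2 / 1 = -1 by norm_num, Real.rpow_neg_one] at this
  simpa using this

/-- Window size of `g_κ`, `(g_κ)'`, `(g_κ)''` in `L¹`: `≤ κ^{-1/2}A`, `≤ κ^{1/2}A`, `≤ κ^{3/2}A`. [folklore] -/
theorem window_bounds :
    (∫ u in (0 : ℝ)..1, |prof J u|) ≤ J.κ ^ (-(1 / 2 : ℝ)) * A ∧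
    (∫ u in (0 : ℝ)..1, |deriv (prof J) u|) ≤ J.κ ^ (1 / 2 : ℝ) * A ∧
    (∫ u in (0 : ℝ)..1, |deriv (deriv (prof J)) u|) ≤ J.κ ^ (3 / 2 : ℝ) * A := by
  have hκ0 : 0 < J.κ := by linarith [h.hκ]
  have e1 : J.κ * J.κ ^ (-(1 / 2 : ℝ)) = J.κ ^ (1 / 2 : ℝ) := by
    rw [show J.κ * J.κ ^ (-(1 / 2 : ℝ)) = J.κ ^ (1 : ℝ) * J.κ ^ (-(1 / 2 : ℝ)) by rw [Real.rpow_one],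
      ← Real.rpow_add hκ0]; norm_num
  have e2 : J.κ ^ 2 * J.κ ^ (-(1 / 2 : ℝ)) = J.κ ^ (3 / 2 : ℝ) := by
    rw [show J.κ ^ 2 * J.κ ^ (-(1 / 2 : ℝ)) = J.κ ^ (2 : ℝ) * J.κ ^ (-(1 / 2 : ℝ)) by rw [Real.rpow_two],
      ← Real.rpow_add hκ0]; norm_num
  refine ⟨?_, ?_, ?_⟩
  · rw [intervalIntegral_abs_prof h]
    exact mul_le_mul_of_nonneg_left hc.hIg (Real.rpow_nonneg hκ0.le _)
  · rw [intervalIntegral_abs_deriv_prof h, ← mul_assoc, e1]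
    exact mul_le_mul_of_nonneg_left hc.hIg' (Real.rpow_nonneg hκ0.le _)
  · rw [intervalIntegral_abs_deriv_deriv_prof h, ← mul_assoc, e2]
    exact mul_le_mul_of_nonneg_left hc.hIg'' (Real.rpow_nonneg hκ0.le _)

/-- Generic bound for `∫ |axial| |∂ⱼφ̃|` with an axial profile `P` of window size `≤ a`:
`≤ a C σ⁻¹ μ⁻²`. [folklore] -/
theorem integral_axial_partialDeriv_phiJ_le {P : ℝ → ℝ} (hP : Periodic P 1) (hPc : Continuous P) {a : ℝ}
    (ha : ∫ u in (0 : ℝ)..1, |P u| ≤ a) (r : ℝ) (j : 𝔡) :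
    ∫ y, |axialFn hP (nvec J x) r y| * |Torus.partialDeriv j (phiJ J s x) y| ≤ a * C * ((J.σ : ℝ))⁻¹ * J.μ ^ (-(2 : ℝ)) := by
  have hσ0 : (0 : ℝ) ≤ ((J.σ : ℝ))⁻¹ := inv_nonneg.2 (Nat.cast_nonneg _)
  have := integral_abs_mul_abs_le s h hP hPc continuous_id (isPullOf_partialDeriv_phi x h.hμ j) continuous_id r
    (a := a) (b := C * J.μ ^ (-(2 : ℝ))) (by simpa using ha) (by simpa using integral_abs_partialDeriv_phi_le h hc j)
    (intervalIntegral_abs_nonneg _)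
  calc ∫ y, |axialFn hP (nvec J x) r y| * |Torus.partialDeriv j (phiJ J s x) y|
      = ∫ y, ((J.σ : ℝ))⁻¹ * (|axialFn hP (nvec J x) r y| * |Torus.partialDeriv j (phi x J.μ) (J.σ • y - J.σ • s x)|) := by
        refine integral_congr_ae (ae_of_all _ fun y => ?_)
        simp only [partialDeriv_phiJ_eq s h x j y, abs_mul, abs_of_nonneg hσ0]
        ring
    _ = ((J.σ : ℝ))⁻¹ * ∫ y, |axialFn hP (nvec J x) r y| * |Torus.partialDeriv j (phi x J.μ) (J.σ • y - J.σ • s x)| :=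
        integral_const_mul _ _
    _ ≤ ((J.σ : ℝ))⁻¹ * (a * (C * J.μ ^ (-(2 : ℝ)))) := mul_le_mul_of_nonneg_left (by simpa using this) hσ0
    _ = a * C * ((J.σ : ℝ))⁻¹ * J.μ ^ (-(2 : ℝ)) := by ring

/-- `∫ |η_x| |∂ⱼφ̃_x| ≤ A C κ^{-1/2} σ⁻¹ μ⁻²`. [cite: BuckmasterVicol2020, §7.4 (7.24)] -/
theorem integral_eta_partialDeriv_phiJ_le (t : ℝ) (j : 𝔡) :
    ∫ y, |eta J x t y| * |Torus.partialDeriv j (phiJ J s x) y| ≤ A * C * J.κ ^ (-(1 / 2 : ℝ)) * ((J.σ : ℝ))⁻¹ * J.μ ^ (-(2 : ℝ)) := by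
  have := integral_axial_partialDeriv_phiJ_le s h hc (prof_periodic J) (contDiff_prof h).continuous (window_bounds h hc).1 (J.om * t) j
  calc _ = _ := by simp only [eta]
    _ ≤ J.κ ^ (-(1 / 2 : ℝ)) * A * C * ((J.σ : ℝ))⁻¹ * J.μ ^ (-(2 : ℝ)) := this
    _ = _ := by ring

/-- `∫ |η'_x| |∂ⱼφ̃_x| ≤ A C κ^{1/2} σ⁻¹ μ⁻²`. [cite: BuckmasterVicol2020, §7.4 (7.24)] -/
theorem integral_etaD_partialDeriv_phiJ_le (t : ℝ) (j : 𝔡) :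
    ∫ y, |etaD J x t y| * |Torus.partialDeriv j (phiJ J s x) y| ≤ A * C * J.κ ^ (1 / 2 : ℝ) * ((J.σ : ℝ))⁻¹ * J.μ ^ (-(2 : ℝ)) := by
  have := integral_axial_partialDeriv_phiJ_le s h hc (periodic_deriv (prof_periodic J)) (contDiff_deriv_prof h).continuous
    (window_bounds h hc).2.1 (J.om * t) j
  calc _ = _ := by simp only [etaD]
    _ ≤ J.κ ^ (1 / 2 : ℝ) * A * C * ((J.σ : ℝ))⁻¹ * J.μ ^ (-(2 : ℝ)) := this
    _ = _ := by ring

/-- `∫ |η''_x| |∂ⱼφ̃_x| ≤ A C κ^{3/2} σ⁻¹ μ⁻²`. [cite: BuckmasterVicol2020, §7.4 (7.24)] -/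
theorem integral_etaDD_partialDeriv_phiJ_le (t : ℝ) (j : 𝔡) :
    ∫ y, |etaDD J x t y| * |Torus.partialDeriv j (phiJ J s x) y| ≤ A * C * J.κ ^ (3 / 2 : ℝ) * ((J.σ : ℝ))⁻¹ * J.μ ^ (-(2 : ℝ)) := by
  have := integral_axial_partialDeriv_phiJ_le s h hc (periodic_deriv (periodic_deriv (prof_periodic J)))
    (contDiff_deriv_deriv_prof h).continuous (window_bounds h hc).2.2 (J.om * t) j
  calc _ = _ := by simp only [etaDD]
    _ ≤ J.κ ^ (3 / 2 : ℝ) * A * C * ((J.σ : ℝ))⁻¹ * J.μ ^ (-(2 : ℝ)) := this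
    _ = _ := by ring

/-- Generic bound for `∫ |axial| |∂ᵢ∂ⱼφ̃|` with window size `≤ a`: `≤ a C μ⁻¹`. [folklore] -/
theorem integral_axial_partialDeriv_partialDeriv_phiJ_le {P : ℝ → ℝ} (hP : Periodic P 1) (hPc : Continuous P) {a : ℝ}
    (ha : ∫ u in (0 : ℝ)..1, |P u| ≤ a) (r : ℝ) (i j : 𝔡) :
    ∫ y, |axialFn hP (nvec J x) r y| * |Torus.partialDeriv i (Torus.partialDeriv j (phiJ J s x)) y| ≤ a * C * J.μ⁻¹ := by
  have := integral_abs_mul_abs_le s h hP hPc continuous_id (isPullOf_partialDeriv_partialDeriv_phi x h.hμ i j)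
    continuous_id r (a := a) (b := C * J.μ⁻¹) (by simpa using ha)
    (by simpa using integral_abs_partialDeriv_partialDeriv_phi_le h hc i j) (intervalIntegral_abs_nonneg _)
  calc ∫ y, |axialFn hP (nvec J x) r y| * |Torus.partialDeriv i (Torus.partialDeriv j (phiJ J s x)) y|
      = ∫ y, |axialFn hP (nvec J x) r y| * |Torus.partialDeriv i (Torus.partialDeriv j (phi x J.μ)) (J.σ • y - J.σ • s x)| := by
        simp only [partialDeriv_partialDeriv_phiJ_eq s h x i j]
    _ ≤ a * (C * J.μ⁻¹) := by simpa using this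
    _ = a * C * J.μ⁻¹ := by ring

/-- `∫ |η'_x| |∂ᵢ∂ⱼφ̃_x| ≤ A C κ^{1/2} μ⁻¹`. [cite: BuckmasterVicol2020, §7.4 (7.24)] -/
theorem integral_etaD_partialDeriv_partialDeriv_phiJ_le (t : ℝ) (i j : 𝔡) :
    ∫ y, |etaD J x t y| * |Torus.partialDeriv i (Torus.partialDeriv j (phiJ J s x)) y| ≤ A * C * J.κ ^ (1 / 2 : ℝ) * J.μ⁻¹ := by
  have := integral_axial_partialDeriv_partialDeriv_phiJ_le s h hc (periodic_deriv (prof_periodic J)) (contDiff_deriv_prof h).continuous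
    (window_bounds h hc).2.1 (J.om * t) i j
  calc _ = _ := by simp only [etaD]
    _ ≤ J.κ ^ (1 / 2 : ℝ) * A * C * J.μ⁻¹ := this
    _ = _ := by ring

/-- `∫ |η_x| |∂ᵢ∂ⱼφ̃_x| ≤ A C κ^{-1/2} μ⁻¹`. [cite: BuckmasterVicol2020, §7.4 (7.24)] -/
theorem integral_eta_partialDeriv_partialDeriv_phiJ_le (t : ℝ) (i j : 𝔡) :
    ∫ y, |eta J x t y| * |Torus.partialDeriv i (Torus.partialDeriv j (phiJ J s x)) y| ≤ A * C * J.κ ^ (-(1 / 2 : ℝ)) * J.μ⁻¹ := by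
  have := integral_axial_partialDeriv_partialDeriv_phiJ_le s h hc (prof_periodic J) (contDiff_prof h).continuous
    (window_bounds h hc).1 (J.om * t) i j
  calc _ = _ := by simp only [eta]
    _ ≤ J.κ ^ (-(1 / 2 : ℝ)) * A * C * J.μ⁻¹ := this
    _ = _ := by ring

/-! ### `L²`-type and higher products -/

omit h hc in
/-- Window product bound: `∫₀¹ |f| |f'| ≤ S ∫₀¹ |f'|` when `|f| ≤ S`, for continuous `f`, `f'`. [folklore] -/
theorem intervalIntegral_abs_mul_le {f f' : ℝ → ℝ} (hf' : Continuous f') (hf : Continuous f) {S : ℝ}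
    (hS : ∀ u, |f u| ≤ S) : ∫ u in (0 : ℝ)..1, |f u * f' u| ≤ S * ∫ u in (0 : ℝ)..1, |f' u| := by
  have hS0 : 0 ≤ S := (abs_nonneg _).trans (hS 0)
  calc ∫ u in (0 : ℝ)..1, |f u * f' u| ≤ ∫ u in (0 : ℝ)..1, S * |f' u| := by
        refine intervalIntegral.integral_mono_on zero_le_one ((hf.mul hf').abs.intervalIntegrable _ _)
          ((continuous_const.mul hf'.abs).intervalIntegrable _ _) fun u _ => ?_
        rw [abs_mul]
        exact mul_le_mul_of_nonneg_right (hS u) (abs_nonneg _)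
    _ = S * ∫ u in (0 : ℝ)..1, |f' u| := intervalIntegral.integral_const_mul _ _

omit h hc in
/-- Torus product bound: `∫ |Q₁ Q₂| ≤ S ∫ |Q₂|` when `|Q₁| ≤ S`, for continuous `Q₁`, `Q₂`. [folklore] -/
theorem integral_abs_mul_le' {Q₁ Q₂ : UnitAddTorus 𝔡 → ℝ} (h₁ : Continuous Q₁) (h₂ : Continuous Q₂) {S : ℝ}
    (hS : ∀ z, |Q₁ z| ≤ S) : ∫ z, |Q₁ z * Q₂ z| ≤ S * ∫ z, |Q₂ z| := by
  have hS0 : 0 ≤ S := (abs_nonneg _).trans (hS 0)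
  calc ∫ z, |Q₁ z * Q₂ z| ≤ ∫ z, S * |Q₂ z| := by
        refine integral_mono ((h₁.mul h₂).abs.integrable_unitAddTorus) ((continuous_const.mul h₂.abs).integrable_unitAddTorus)
          fun z => ?_
        simp only [abs_mul]
        exact mul_le_mul_of_nonneg_right (hS z) (abs_nonneg _)
    _ = S * ∫ z, |Q₂ z| := integral_const_mul _ _

/-- `∫ (η'_x)² (∂ⱼφ̃_x)² ≤ A² C² κ² σ⁻² μ⁻²` (`‖W^{(c)}‖²_{L²}`-type). [cite: BuckmasterVicol2020, §7.4 (7.24)] -/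
theorem integral_sq_etaD_partialDeriv_phiJ_le (t : ℝ) (j : 𝔡) :
    ∫ y, etaD J x t y ^ 2 * Torus.partialDeriv j (phiJ J s x) y ^ 2 ≤
      A ^ 2 * C ^ 2 * J.κ ^ 2 * (((J.σ : ℝ))⁻¹) ^ 2 * J.μ ^ (-(2 : ℝ)) := by
  have hκ0 : 0 < J.κ := by linarith [h.hκ]
  have hσ0 : (0 : ℝ) ≤ ((J.σ : ℝ))⁻¹ := inv_nonneg.2 (Nat.cast_nonneg _)
  set P := deriv (prof J) with hPdef
  have hP : Periodic P 1 := periodic_deriv (prof_periodic J)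
  have hPc : Continuous P := (contDiff_deriv_prof h).continuous
  -- window: `∫ P² ≤ sup|P| ∫|P| ≤ κ^{3/2}A κ^{1/2}A`
  have ha : ∫ u in (0 : ℝ)..1, |(fun v => v ^ 2) (P u)| ≤ J.κ ^ 2 * A ^ 2 := by
    have h1 : ∫ u in (0 : ℝ)..1, |(fun v => v ^ 2) (P u)| = ∫ u in (0 : ℝ)..1, |P u * P u| := by
      simp only [pow_two]
    rw [h1]
    calc ∫ u in (0 : ℝ)..1, |P u * P u| ≤ J.κ * (Real.sqrt J.κ * A) * ∫ u in (0 : ℝ)..1, |P u| :=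
          intervalIntegral_abs_mul_le hPc hPc (abs_deriv_prof_le h hc.hg')
      _ ≤ J.κ * (Real.sqrt J.κ * A) * (J.κ ^ (1 / 2 : ℝ) * A) :=
          mul_le_mul_of_nonneg_left (window_bounds h hc).2.1 (by have := hc.hA1; positivity)
      _ = J.κ ^ 2 * A ^ 2 := by
          rw [Real.sqrt_eq_rpow]
          have : J.κ ^ (1 / 2 : ℝ) * J.κ ^ (1 / 2 : ℝ) = J.κ := by
            rw [← Real.rpow_add hκ0]; norm_num
          rw [show J.κ * (J.κ ^ (1 / 2 : ℝ) * A) * (J.κ ^ (1 / 2 : ℝ) * A) = J.κ * (J.κ ^ (1 / 2 : ℝ) * J.κ ^ (1 / 2 : ℝ)) * A ^ 2 by ring,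
            this]; ring
  -- transverse: `∫ (∂φ)² ≤ (C μ⁻¹)²`
  have hb : ∫ z, |(fun v => v ^ 2) (Torus.partialDeriv j (phi x J.μ) z)| ≤ C ^ 2 * J.μ ^ (-(2 : ℝ)) := by
    have := hc.hLdphi J.μ h.hμ 2 (by norm_num) le_rfl j
    have hμ0 : 0 < J.μ := by linarith [h.hμ]
    rw [show -((2 : ℝ) / 2) = -1 by norm_num, Real.rpow_neg_one] at this
    have e : ∀ z, |(fun v => v ^ 2) (Torus.partialDeriv j (phi x J.μ) z)| = |Torus.partialDeriv j (phi x J.μ) z| ^ (2 : ℝ) := by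
      intro z; simp only; rw [Real.rpow_two, abs_pow]
    simp only [e]
    refine this.trans (le_of_eq ?_)
    rw [Real.rpow_two, mul_pow, show J.μ ^ (-(2 : ℝ)) = (J.μ⁻¹) ^ 2 by
      rw [← Real.rpow_neg_one, ← Real.rpow_natCast, ← Real.rpow_mul hμ0.le]; norm_num]
  have := integral_abs_mul_abs_le s h hP hPc (continuous_pow 2) (isPullOf_partialDeriv_phi x h.hμ j) (continuous_pow 2)
    (J.om * t) ha hb (intervalIntegral_abs_nonneg _)
  calc ∫ y, etaD J x t y ^ 2 * Torus.partialDeriv j (phiJ J s x) y ^ 2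
      = ∫ y, (((J.σ : ℝ))⁻¹) ^ 2 * (|(fun v => v ^ 2) (axialFn hP (nvec J x) (J.om * t) y)| *
          |(fun v => v ^ 2) (Torus.partialDeriv j (phi x J.μ) (J.σ • y - J.σ • s x))|) := by
        refine integral_congr_ae (ae_of_all _ fun y => ?_)
        simp only [etaD, hPdef, partialDeriv_phiJ_eq s h x j y, abs_sq]
        ring
    _ = (((J.σ : ℝ))⁻¹) ^ 2 * ∫ y, |(fun v => v ^ 2) (axialFn hP (nvec J x) (J.om * t) y)| *
          |(fun v => v ^ 2) (Torus.partialDeriv j (phi x J.μ) (J.σ • y - J.σ • s x))| := integral_const_mul _ _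
    _ ≤ (((J.σ : ℝ))⁻¹) ^ 2 * (J.κ ^ 2 * A ^ 2 * (C ^ 2 * J.μ ^ (-(2 : ℝ)))) := mul_le_mul_of_nonneg_left this (by positivity)
    _ = _ := by ring

/-- `∫ η_x² (∂ⱼφ̃_x)² ≤ C² σ⁻² μ⁻²`. [cite: BuckmasterVicol2020, §7.4 (7.24)] -/
theorem integral_sq_eta_partialDeriv_phiJ_le (t : ℝ) (j : 𝔡) :
    ∫ y, eta J x t y ^ 2 * Torus.partialDeriv j (phiJ J s x) y ^ 2 ≤ C ^ 2 * (((J.σ : ℝ))⁻¹) ^ 2 * J.μ ^ (-(2 : ℝ)) := by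
  have hσ0 : (0 : ℝ) ≤ ((J.σ : ℝ))⁻¹ := inv_nonneg.2 (Nat.cast_nonneg _)
  have ha : ∫ u in (0 : ℝ)..1, |(fun v => v ^ 2) (prof J u)| ≤ 1 := by
    have e : ∀ u, |(fun v => v ^ 2) (prof J u)| = prof J u ^ 2 := fun u => abs_sq _
    simp only [e, intervalIntegral_prof_sq h]; exact le_rfl
  have hb : ∫ z, |(fun v => v ^ 2) (Torus.partialDeriv j (phi x J.μ) z)| ≤ C ^ 2 * J.μ ^ (-(2 : ℝ)) := by
    have := hc.hLdphi J.μ h.hμ 2 (by norm_num) le_rfl j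
    have hμ0 : 0 < J.μ := by linarith [h.hμ]
    rw [show -((2 : ℝ) / 2) = -1 by norm_num, Real.rpow_neg_one] at this
    have e : ∀ z, |(fun v => v ^ 2) (Torus.partialDeriv j (phi x J.μ) z)| = |Torus.partialDeriv j (phi x J.μ) z| ^ (2 : ℝ) := by
      intro z; simp only; rw [Real.rpow_two, abs_pow]
    simp only [e]
    refine this.trans (le_of_eq ?_)
    rw [Real.rpow_two, mul_pow, show J.μ ^ (-(2 : ℝ)) = (J.μ⁻¹) ^ 2 by
      rw [← Real.rpow_neg_one, ← Real.rpow_natCast, ← Real.rpow_mul hμ0.le]; norm_num]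
  have := integral_abs_mul_abs_le s h (prof_periodic J) (contDiff_prof h).continuous (continuous_pow 2)
    (isPullOf_partialDeriv_phi x h.hμ j) (continuous_pow 2) (J.om * t) ha hb (intervalIntegral_abs_nonneg _)
  calc ∫ y, eta J x t y ^ 2 * Torus.partialDeriv j (phiJ J s x) y ^ 2
      = ∫ y, (((J.σ : ℝ))⁻¹) ^ 2 * (|(fun v => v ^ 2) (axialFn (prof_periodic J) (nvec J x) (J.om * t) y)| *
          |(fun v => v ^ 2) (Torus.partialDeriv j (phi x J.μ) (J.σ • y - J.σ • s x))|) := by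
        refine integral_congr_ae (ae_of_all _ fun y => ?_)
        simp only [eta, partialDeriv_phiJ_eq s h x j y, abs_sq]
        ring
    _ = (((J.σ : ℝ))⁻¹) ^ 2 * ∫ y, |(fun v => v ^ 2) (axialFn (prof_periodic J) (nvec J x) (J.om * t) y)| *
          |(fun v => v ^ 2) (Torus.partialDeriv j (phi x J.μ) (J.σ • y - J.σ • s x))| := integral_const_mul _ _
    _ ≤ (((J.σ : ℝ))⁻¹) ^ 2 * (1 * (C ^ 2 * J.μ ^ (-(2 : ℝ)))) := mul_le_mul_of_nonneg_left this (by positivity)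
    _ = _ := by ring

/-- `∫ (η_x² ψ̃_x²)² ≤ A² C² κ μ²` (`‖η²ψ̃²‖²_{L²}`, the size of `w^{(t)}` in `L²`). [cite: BuckmasterVicol2020, §7.5.4 (7.43c)] -/
theorem integral_fastF_sq_le (t : ℝ) : ∫ y, fastF J s x t y ^ 2 ≤ A ^ 2 * C ^ 2 * J.κ * J.μ ^ 2 := by
  have hκ0 : 0 < J.κ := by linarith [h.hκ]
  have hμ1 := h.hμ
  -- window: `∫ P⁴ ≤ (sup P)² ∫P² = κ A²`
  have ha : ∫ u in (0 : ℝ)..1, |(fun v => v ^ 4) (prof J u)| ≤ J.κ * A ^ 2 := by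
    have hsup : ∀ u, |prof J u| ≤ Real.sqrt J.κ * A := abs_prof_le hc.hg
    have e : ∀ u, |(fun v => v ^ 4) (prof J u)| = |prof J u ^ 2 * prof J u ^ 2| := by
      intro u; simp only; rw [← pow_add]
    simp only [e]
    have hc2 : Continuous fun u => prof J u ^ 2 := (contDiff_prof h).continuous.pow 2
    calc ∫ u in (0 : ℝ)..1, |prof J u ^ 2 * prof J u ^ 2| ≤ (Real.sqrt J.κ * A) ^ 2 * ∫ u in (0 : ℝ)..1, |prof J u ^ 2| := by
          refine intervalIntegral_abs_mul_le hc2 hc2 fun u => ?_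
          rw [abs_pow]
          exact pow_le_pow_left₀ (abs_nonneg _) (hsup u) 2
      _ = (Real.sqrt J.κ * A) ^ 2 * 1 := by
          congr 1
          have e2 : ∀ u, |prof J u ^ 2| = prof J u ^ 2 := fun u => abs_sq _
          simp only [e2, intervalIntegral_prof_sq h]
      _ = J.κ * A ^ 2 := by rw [mul_pow, Real.sq_sqrt hκ0.le]; ring
  -- transverse: `∫ ψ⁴ ≤ (sup|ψ|)² ∫ψ² = C²μ²`
  have hb : ∫ z, |(fun v => v ^ 4) (psi x J.μ z)| ≤ C ^ 2 * J.μ ^ 2 := by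
    have hsup : ∀ z, |psi x J.μ z| ≤ C * J.μ := hc.hpsi J.μ hμ1
    have e : ∀ z, |(fun v => v ^ 4) (psi x J.μ z)| = |psi x J.μ z ^ 2 * psi x J.μ z ^ 2| := by
      intro z; simp only; rw [← pow_add]
    simp only [e]
    have hc2 : Continuous fun z => psi x J.μ z ^ 2 := (isSmooth_psi x hμ1).continuous.pow 2
    calc ∫ z, |psi x J.μ z ^ 2 * psi x J.μ z ^ 2| ≤ (C * J.μ) ^ 2 * ∫ z, |psi x J.μ z ^ 2| := by
          refine integral_abs_mul_le' hc2 hc2 fun z => ?_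
          rw [abs_pow]
          exact pow_le_pow_left₀ (abs_nonneg _) (hsup z) 2
      _ = (C * J.μ) ^ 2 * 1 := by
          congr 1
          have e2 : ∀ z, |psi x J.μ z ^ 2| = psi x J.μ z ^ 2 := fun z => abs_sq _
          simp only [e2]
          exact integral_psi_sq (by norm_num [Fintype.card_fin]) x hμ1
      _ = C ^ 2 * J.μ ^ 2 := by ring
  have := integral_abs_mul_abs_le s h (prof_periodic J) (contDiff_prof h).continuous (continuous_pow 4)
    (isPullOf_psi x hμ1) (continuous_pow 4) (J.om * t) ha hb (intervalIntegral_abs_nonneg _)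
  calc ∫ y, fastF J s x t y ^ 2
      = ∫ y, |(fun v => v ^ 4) (axialFn (prof_periodic J) (nvec J x) (J.om * t) y)| * |(fun v => v ^ 4) (psi x J.μ (J.σ • y - J.σ • s x))| := by
        refine integral_congr_ae (ae_of_all _ fun y => ?_)
        have h4 : Even 4 := by norm_num
        simp only [fastF, eta, psiJ_eq s x]
        rw [abs_pow, abs_pow, h4.pow_abs, h4.pow_abs]
        ring
    _ ≤ J.κ * A ^ 2 * (C ^ 2 * J.μ ^ 2) := this
    _ = _ := by ring

/-- `∫ |η_x η'_x| ψ̃_x² ≤ A² κ` (for `∇(η²ψ̃²)` in `L¹`, axial part). [cite: BuckmasterVicol2020, §7.6.2] -/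
theorem integral_eta_etaD_psi_sq_le (t : ℝ) : ∫ y, |eta J x t y * etaD J x t y| * psiJ J s x y ^ 2 ≤ A ^ 2 * J.κ := by
  have hκ0 : 0 < J.κ := by linarith [h.hκ]
  have hμ1 := h.hμ
  have hPQc : Continuous (prof J * deriv (prof J)) := (contDiff_prof h).continuous.mul (contDiff_deriv_prof h).continuous
  have ha : ∫ u in (0 : ℝ)..1, |(fun v => v) ((prof J * deriv (prof J)) u)| ≤ J.κ * A ^ 2 := by
    simp only [Pi.mul_apply]
    calc ∫ u in (0 : ℝ)..1, |prof J u * deriv (prof J) u| ≤ Real.sqrt J.κ * A * ∫ u in (0 : ℝ)..1, |deriv (prof J) u| :=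
          intervalIntegral_abs_mul_le (contDiff_deriv_prof h).continuous (contDiff_prof h).continuous (abs_prof_le hc.hg)
      _ ≤ Real.sqrt J.κ * A * (J.κ ^ (1 / 2 : ℝ) * A) :=
          mul_le_mul_of_nonneg_left (window_bounds h hc).2.1 (by have := hc.hA1; positivity)
      _ = J.κ * A ^ 2 := by
          rw [Real.sqrt_eq_rpow]
          have : J.κ ^ (1 / 2 : ℝ) * J.κ ^ (1 / 2 : ℝ) = J.κ := by rw [← Real.rpow_add hκ0]; norm_num
          rw [show J.κ ^ (1 / 2 : ℝ) * A * (J.κ ^ (1 / 2 : ℝ) * A) = (J.κ ^ (1 / 2 : ℝ) * J.κ ^ (1 / 2 : ℝ)) * A ^ 2 by ring, this]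
  have hb : ∫ z, |(fun v => v ^ 2) (psi x J.μ z)| ≤ 1 := by
    have e2 : ∀ z, |(fun v => v ^ 2) (psi x J.μ z)| = psi x J.μ z ^ 2 := fun z => abs_sq _
    simp only [e2]
    exact (integral_psi_sq (by norm_num [Fintype.card_fin]) x hμ1).le
  have := integral_abs_mul_abs_le s h ((prof_periodic J).mul (periodic_deriv (prof_periodic J))) hPQc continuous_id
    (isPullOf_psi x hμ1) (continuous_pow 2) (J.om * t) ha hb (intervalIntegral_abs_nonneg _)
  calc ∫ y, |eta J x t y * etaD J x t y| * psiJ J s x y ^ 2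
      = ∫ y, |(fun v => v) (axialFn ((prof_periodic J).mul (periodic_deriv (prof_periodic J))) (nvec J x) (J.om * t) y)| *
          |(fun v => v ^ 2) (psi x J.μ (J.σ • y - J.σ • s x))| := by
        refine integral_congr_ae (ae_of_all _ fun y => ?_)
        simp only [eta, etaD, psiJ_eq s x, abs_sq]
        rw [axialFn_mul]
    _ ≤ J.κ * A ^ 2 * 1 := this
    _ = A ^ 2 * J.κ := by ring

/-- `∫ η_x² |ψ̃_x ∂ₗψ̃_x| ≤ C² σ μ` (for `∇(η²ψ̃²)` in `L¹`, transverse part). [cite: BuckmasterVicol2020, §7.6.2] -/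
theorem integral_eta_sq_psi_partialDeriv_psiJ_le (t : ℝ) (l : 𝔡) :
    ∫ y, eta J x t y ^ 2 * |psiJ J s x y * Torus.partialDeriv l (psiJ J s x) y| ≤ C ^ 2 * J.σ * J.μ := by
  have hμ1 := h.hμ
  have hσ0 : (0 : ℝ) ≤ J.σ := Nat.cast_nonneg _
  have ha : ∫ u in (0 : ℝ)..1, |(fun v => v ^ 2) (prof J u)| ≤ 1 := by
    have e : ∀ u, |(fun v => v ^ 2) (prof J u)| = prof J u ^ 2 := fun u => abs_sq _
    simp only [e, intervalIntegral_prof_sq h]; exact le_rfl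
  have hb : ∫ z, |(fun v => v) (psi x J.μ z * Torus.partialDeriv l (psi x J.μ) z)| ≤ C * J.μ * C := by
    simp only
    calc ∫ z, |psi x J.μ z * Torus.partialDeriv l (psi x J.μ) z| ≤ C * J.μ * ∫ z, |Torus.partialDeriv l (psi x J.μ) z| :=
          integral_abs_mul_le' (isSmooth_psi x hμ1).continuous ((isSmooth_psi x hμ1).partialDeriv l).continuous (hc.hpsi J.μ hμ1)
      _ ≤ C * J.μ * C := by
          refine mul_le_mul_of_nonneg_left ?_ (by have := hc.hC1; positivity)
          have := hc.hLdpsi J.μ hμ1 1 le_rfl (by norm_num) l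
          rw [show (2 : ℝ) - 2 / 1 = 0 by norm_num, Real.rpow_zero] at this
          simpa using this
  have hQ : IsPullOf x (fun z => psi x J.μ z * Torus.partialDeriv l (psi x J.μ) z) :=
    (isPullOf_psi x hμ1).mul (isPullOf_partialDeriv_psi x hμ1 l)
  have := integral_abs_mul_abs_le s h (prof_periodic J) (contDiff_prof h).continuous (continuous_pow 2) hQ continuous_id
    (J.om * t) ha hb (intervalIntegral_abs_nonneg _)
  calc ∫ y, eta J x t y ^ 2 * |psiJ J s x y * Torus.partialDeriv l (psiJ J s x) y|
      = ∫ y, (J.σ : ℝ) * (|(fun v => v ^ 2) (axialFn (prof_periodic J) (nvec J x) (J.om * t) y)| *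
          |(fun v => v) (psi x J.μ (J.σ • y - J.σ • s x) * Torus.partialDeriv l (psi x J.μ) (J.σ • y - J.σ • s x))|) := by
        refine integral_congr_ae (ae_of_all _ fun y => ?_)
        simp only [eta, psiJ_eq s x, partialDeriv_psiJ_eq s x l y, abs_mul, abs_of_nonneg hσ0, abs_sq]
        ring
    _ = (J.σ : ℝ) * ∫ y, |(fun v => v ^ 2) (axialFn (prof_periodic J) (nvec J x) (J.om * t) y)| *
          |(fun v => v) (psi x J.μ (J.σ • y - J.σ • s x) * Torus.partialDeriv l (psi x J.μ) (J.σ • y - J.σ • s x))| :=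
        integral_const_mul _ _
    _ ≤ (J.σ : ℝ) * (1 * (C * J.μ * C)) := mul_le_mul_of_nonneg_left this hσ0
    _ = C ^ 2 * J.σ * J.μ := by ring

/-! ### `L^p` bounds of `η ∂φ̃`, `η' ∂φ̃` (`1 ≤ p ≤ 2`) -/

/-- Generic `L^p` product bound: for an axial profile `P` with `|P| ≤ S` and `∫₀¹|P| ≤ a`,
`∫ |P̃ ∂ⱼφ̃|^p ≤ σ^{-p} (S^{p-1} a) (C μ^{-2/p})^p`. [cite: BuckmasterVicol2020, §7.4 (7.24)] -/
theorem integral_rpow_axial_partialDeriv_phiJ_le {P : ℝ → ℝ} (hP : Periodic P 1) (hPc : Continuous P) {S a : ℝ}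
    (hS : ∀ u, |P u| ≤ S) (ha : ∫ u in (0 : ℝ)..1, |P u| ≤ a) {p : ℝ} (hp : 1 ≤ p) (hp2 : p ≤ 2) (r : ℝ) (j : 𝔡) :
    ∫ y, |axialFn hP (nvec J x) r y * Torus.partialDeriv j (phiJ J s x) y| ^ p ≤
      (((J.σ : ℝ))⁻¹) ^ p * (S ^ (p - 1) * a) * (C * J.μ ^ (-(2 / p))) ^ p := by
  have hp0 : 0 ≤ p := by linarith
  have hσ0 : (0 : ℝ) ≤ ((J.σ : ℝ))⁻¹ := inv_nonneg.2 (Nat.cast_nonneg _)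
  have hS0 : 0 ≤ S := (abs_nonneg _).trans (hS 0)
  have hμ0 : 0 ≤ J.μ := by linarith [h.hμ]
  -- window: `∫ |P|^p ≤ S^{p-1} ∫|P| ≤ S^{p-1} a`
  have hF : Continuous fun v : ℝ => |v| ^ p := continuous_abs.rpow_const fun _ => Or.inr hp0
  have ha' : ∫ u in (0 : ℝ)..1, |(fun v : ℝ => |v| ^ p) (P u)| ≤ S ^ (p - 1) * a := by
    have e : ∀ u, |(fun v : ℝ => |v| ^ p) (P u)| = |P u| ^ p := fun u => abs_of_nonneg (Real.rpow_nonneg (abs_nonneg _) _)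
    simp only [e]
    have hpt : ∀ u, |P u| ^ p ≤ S ^ (p - 1) * |P u| := by
      intro u
      have hab : 0 ≤ |P u| := abs_nonneg _
      calc |P u| ^ p = |P u| ^ (p - 1) * |P u| := by rw [← Real.rpow_add_one' hab (by linarith), sub_add_cancel]
        _ ≤ S ^ (p - 1) * |P u| := mul_le_mul_of_nonneg_right (Real.rpow_le_rpow hab (hS u) (by linarith)) hab
    calc ∫ u in (0 : ℝ)..1, |P u| ^ p ≤ ∫ u in (0 : ℝ)..1, S ^ (p - 1) * |P u| :=
          intervalIntegral.integral_mono_on zero_le_one ((hF.comp hPc).intervalIntegrable _ _)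
            ((continuous_const.mul hPc.abs).intervalIntegrable _ _) fun u _ => hpt u
      _ = S ^ (p - 1) * ∫ u in (0 : ℝ)..1, |P u| := intervalIntegral.integral_const_mul _ _
      _ ≤ S ^ (p - 1) * a := mul_le_mul_of_nonneg_left ha (Real.rpow_nonneg hS0 _)
  have hb' : ∫ z, |(fun v : ℝ => |v| ^ p) (Torus.partialDeriv j (phi x J.μ) z)| ≤ (C * J.μ ^ (-(2 / p))) ^ p := by
    have e : ∀ z, |(fun v : ℝ => |v| ^ p) (Torus.partialDeriv j (phi x J.μ) z)| = |Torus.partialDeriv j (phi x J.μ) z| ^ p :=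
      fun z => abs_of_nonneg (Real.rpow_nonneg (abs_nonneg _) _)
    simp only [e]
    exact hc.hLdphi J.μ h.hμ p hp hp2 j
  have := integral_abs_mul_abs_le s h hP hPc hF (isPullOf_partialDeriv_phi x h.hμ j) hF r ha' hb' (intervalIntegral_abs_nonneg _)
  calc ∫ y, |axialFn hP (nvec J x) r y * Torus.partialDeriv j (phiJ J s x) y| ^ p
      = ∫ y, (((J.σ : ℝ))⁻¹) ^ p * (|(fun v : ℝ => |v| ^ p) (axialFn hP (nvec J x) r y)| *
          |(fun v : ℝ => |v| ^ p) (Torus.partialDeriv j (phi x J.μ) (J.σ • y - J.σ • s x))|) := by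
        refine integral_congr_ae (ae_of_all _ fun y => ?_)
        simp only [partialDeriv_phiJ_eq s h x j y, abs_of_nonneg (Real.rpow_nonneg (abs_nonneg _) _)]
        rw [abs_mul, abs_mul, abs_of_nonneg hσ0, Real.mul_rpow (abs_nonneg _) (mul_nonneg hσ0 (abs_nonneg _)),
          Real.mul_rpow hσ0 (abs_nonneg _)]
        ring
    _ = (((J.σ : ℝ))⁻¹) ^ p * ∫ y, |(fun v : ℝ => |v| ^ p) (axialFn hP (nvec J x) r y)| *
          |(fun v : ℝ => |v| ^ p) (Torus.partialDeriv j (phi x J.μ) (J.σ • y - J.σ • s x))| := integral_const_mul _ _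
    _ ≤ (((J.σ : ℝ))⁻¹) ^ p * ((S ^ (p - 1) * a) * (C * J.μ ^ (-(2 / p))) ^ p) :=
        mul_le_mul_of_nonneg_left this (Real.rpow_nonneg hσ0 _)
    _ = _ := by ring

/-- `∫ |η'_x ∂ⱼφ̃_x|^p ≤ σ^{-p} ((κ^{3/2}A)^{p-1} κ^{1/2}A) (Cμ^{-2/p})^p` (`= (A C κ^{3/2-1/p} σ⁻¹ μ^{-2/p})^p`;
the `L^p` size of `∂ₜOm`, `1 ≤ p ≤ 2`). [cite: BuckmasterVicol2020, §7.4 (7.24)] -/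
theorem integral_rpow_etaD_partialDeriv_phiJ_le {p : ℝ} (hp : 1 ≤ p) (hp2 : p ≤ 2) (t : ℝ) (j : 𝔡) :
    ∫ y, |etaD J x t y * Torus.partialDeriv j (phiJ J s x) y| ^ p ≤
      (((J.σ : ℝ))⁻¹) ^ p * ((J.κ ^ (3 / 2 : ℝ) * A) ^ (p - 1) * (J.κ ^ (1 / 2 : ℝ) * A)) * (C * J.μ ^ (-(2 / p))) ^ p := by
  have hκ0 : 0 ≤ J.κ := by linarith [h.hκ]
  have hS : ∀ u, |deriv (prof J) u| ≤ J.κ ^ (3 / 2 : ℝ) * A := by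
    intro u
    have := abs_deriv_prof_le h hc.hg' u
    rwa [Real.sqrt_eq_rpow, ← mul_assoc, show J.κ * J.κ ^ (1 / 2 : ℝ) = J.κ ^ (3 / 2 : ℝ) by
      rw [show (3 / 2 : ℝ) = 1 + 1 / 2 by norm_num, Real.rpow_add_of_nonneg hκ0 (by norm_num) (by norm_num), Real.rpow_one]] at this
  have := integral_rpow_axial_partialDeriv_phiJ_le s h hc (periodic_deriv (prof_periodic J)) (contDiff_deriv_prof h).continuous
    hS (window_bounds h hc).2.1 hp hp2 (J.om * t) j
  simpa only [etaD] using this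

/-- `∫ |η_x ∂ⱼφ̃_x|^p ≤ σ^{-p} ((κ^{1/2}A)^{p-1} κ^{-1/2}A) (Cμ^{-2/p})^p` (`= (A C κ^{1/2-1/p} σ⁻¹ μ^{-2/p})^p`).
[cite: BuckmasterVicol2020, §7.4 (7.24)] -/
theorem integral_rpow_eta_partialDeriv_phiJ_le {p : ℝ} (hp : 1 ≤ p) (hp2 : p ≤ 2) (t : ℝ) (j : 𝔡) :
    ∫ y, |eta J x t y * Torus.partialDeriv j (phiJ J s x) y| ^ p ≤
      (((J.σ : ℝ))⁻¹) ^ p * ((J.κ ^ (1 / 2 : ℝ) * A) ^ (p - 1) * (J.κ ^ (-(1 / 2 : ℝ)) * A)) * (C * J.μ ^ (-(2 / p))) ^ p := by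
  have hS : ∀ u, |prof J u| ≤ J.κ ^ (1 / 2 : ℝ) * A := by
    intro u
    have := abs_prof_le hc.hg u
    rwa [Real.sqrt_eq_rpow] at this
  have := integral_rpow_axial_partialDeriv_phiJ_le s h hc (prof_periodic J) (contDiff_prof h).continuous hS
    (window_bounds h hc).1 hp hp2 (J.om * t) j
  simpa only [eta] using this

/-! ### The oscillation potential gains one cell frequency -/

omit h hc in
/-- `η²ψ̃² - 1 = G₀(σ • ·)` as functions. [folklore] -/
theorem fastF_sub_one_eq (t : ℝ) : (fun y => fastF J s x t y - 1) = fun y => fastBase J s x t (J.σ • y) := by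
  funext y; rw [fastF_eq s x t y]; ring

omit hc in
/-- `∫ |G₀| ≤ 2`. [folklore] -/
theorem integral_abs_fastBase_le (t : ℝ) : ∫ z, |fastBase J s x t z| ≤ 2 := by
  have hd : 2 ≤ Fintype.card 𝔡 := by norm_num [Fintype.card_fin]
  set F : UnitAddTorus 𝔡 → ℝ := fun z => axialFn (prof_periodic J) (dir x) (J.om * t) z ^ 2 * psi x J.μ (z - J.σ • s x) ^ 2 with hF
  have hFc : Continuous F := by
    have hc1 : Continuous (axialFn (prof_periodic J) (dir x) (J.om * t)) := (isSmooth_axialFn _ (contDiff_prof h) _ _).continuous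
    have hc2 : Continuous (fun z : UnitAddTorus 𝔡 => psi x J.μ (z - J.σ • s x)) := (isSmooth_comp_sub (isSmooth_psi x h.hμ) _).continuous
    exact (hc1.pow 2).mul (hc2.pow 2)
  have hF0 : ∀ z, 0 ≤ F z := fun z => mul_nonneg (sq_nonneg _) (sq_nonneg _)
  have hFint : Integrable F volume := hFc.integrable_unitAddTorus
  have hF1 : ∫ z, F z = 1 := by
    have h0 := integral_fastBase s h hd x t
    have e : (fun z => fastBase J s x t z) = fun z => F z - 1 := rfl
    rw [e, integral_sub hFint (integrable_const 1)] at h0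
    simp only [integral_const, probReal_univ, one_smul] at h0
    linarith
  have hpt : ∀ z, |fastBase J s x t z| ≤ F z + 1 := by
    intro z
    show |F z - 1| ≤ F z + 1
    rw [abs_le]; constructor <;> linarith [hF0 z]
  calc ∫ z, |fastBase J s x t z| ≤ ∫ z, (F z + 1) :=
        integral_mono (isSmooth_fastBase s h x t).continuous.abs.integrable_unitAddTorus (hFint.add (integrable_const 1)) hpt
    _ = 2 := by rw [integral_add hFint (integrable_const 1), hF1]; norm_num

omit hc in
/-- **`‖∇Δ⁻¹(η²ψ̃² - 1)‖_{L¹} ≤ 2K σ⁻¹`**, `K` the `L¹ → L¹` bound of `∇Δ⁻¹` (the oscillation error gains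
the minimal active frequency `σ = r_⊥λ`; BV §7.6.2: "we expect the inverse divergence operator
`ℛ` to gain a factor of `r_⊥λ_{q+1}`"). [cite: BuckmasterVicol2020, §7.6.2 (7.58)] -/
theorem integral_abs_partialDeriv_invLaplacian_fastF_le {K : ℝ≥0}
    (hK : ∀ g : UnitAddTorus 𝔡 → ℝ, IsSmooth g → ∀ i : 𝔡,
      eLpNorm (Torus.partialDeriv i (invLaplacian g)) 1 volume ≤ K * eLpNorm g 1 volume) (t : ℝ) (l : 𝔡) :
    ∫ y, |Torus.partialDeriv l (invLaplacian fun y => fastF J s x t y - 1) y| ≤ 2 * K * ((J.σ : ℝ))⁻¹ := by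
  have hd : 2 ≤ Fintype.card 𝔡 := by norm_num [Fintype.card_fin]
  have hσ' : (J.σ : ℝ) ≠ 0 := by exact_mod_cast h.hσ.ne'
  have hσ0 : (0 : ℝ) ≤ ((J.σ : ℝ))⁻¹ := inv_nonneg.2 (Nat.cast_nonneg _)
  have hG := isSmooth_fastBase s h x t
  have hIG := isSmooth_invLaplacian hG
  rw [fastF_sub_one_eq s, invLaplacian_comp_nsmul hG (integral_fastBase s h hd x t) h.hσ]
  -- `∂ₗ` of the rescaled potential
  have hc1 : Torus.IsContDiff 1 (fun z : UnitAddTorus 𝔡 => invLaplacian (fastBase J s x t) (J.σ • z)) :=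
    (isSmooth_comp_nsmul hIG J.σ).isContDiff (by simp)
  have e : ∀ y, Torus.partialDeriv l (fun y => (((J.σ : ℝ)) ^ 2)⁻¹ * invLaplacian (fastBase J s x t) (J.σ • y)) y =
      ((J.σ : ℝ))⁻¹ * Torus.partialDeriv l (invLaplacian (fastBase J s x t)) (J.σ • y) := by
    intro y
    rw [Torus.partialDeriv_const_mul_apply hc1, partialDeriv_comp_nsmul, smul_eq_mul]
    field_simp
  simp only [e, abs_mul, abs_of_nonneg hσ0]
  rw [integral_const_mul, integral_comp_nsmul h.hσ (hIG.partialDeriv l).continuous.abs.aestronglyMeasurable]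
  have hop := integral_abs_le_of_eLpNorm_one_le (hIG.partialDeriv l).continuous hG.continuous (hK _ hG l)
  calc ((J.σ : ℝ))⁻¹ * ∫ y, |Torus.partialDeriv l (invLaplacian (fastBase J s x t)) y|
      ≤ ((J.σ : ℝ))⁻¹ * (K * 2) := mul_le_mul_of_nonneg_left (hop.trans (mul_le_mul_of_nonneg_left
        (integral_abs_fastBase_le s h t) K.coe_nonneg)) hσ0
    _ = 2 * K * ((J.σ : ℝ))⁻¹ := by ring

end Bounds

/-! ## Packaging: all bounds with one constant -/

section Package

variable (B : ℝ) (J : Params) (s : Index 𝔡 → UnitAddTorus 𝔡) (x : Index 𝔡) (t : ℝ)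

/-- **The size bounds of the intermittent jet of direction `x` at time `t`**, with one constant `B`
(BV (7.22)–(7.24) in the tree's parametrisation; see the file header for the dictionary).
[cite: BuckmasterVicol2020, §7.4 (7.22)–(7.24)] -/
structure Bounds : Prop where
  eta_le : ∀ y, |eta J x t y| ≤ B * J.κ ^ (1 / 2 : ℝ)
  etaD_le : ∀ y, |etaD J x t y| ≤ B * J.κ ^ (3 / 2 : ℝ)
  etaDD_le : ∀ y, |etaDD J x t y| ≤ B * J.κ ^ (5 / 2 : ℝ)
  psiJ_le : ∀ y, |psiJ J s x y| ≤ B * J.μ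
  partialDeriv_psiJ_le : ∀ l y, |Torus.partialDeriv l (psiJ J s x) y| ≤ B * J.σ * J.μ ^ 2
  partialDeriv_phiJ_le : ∀ l y, |Torus.partialDeriv l (phiJ J s x) y| ≤ B * ((J.σ : ℝ))⁻¹
  partialDeriv_partialDeriv_phiJ_le : ∀ i l y, |Torus.partialDeriv i (Torus.partialDeriv l (phiJ J s x)) y| ≤ B * J.μ
  int_eta_psi : ∫ y, |eta J x t y| * |psiJ J s x y| ≤ B * J.κ ^ (-(1 / 2 : ℝ)) * J.μ⁻¹
  int_etaD_psi : ∫ y, |etaD J x t y| * |psiJ J s x y| ≤ B * J.κ ^ (1 / 2 : ℝ) * J.μ⁻¹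
  int_eta_dpsi : ∀ l, ∫ y, |eta J x t y| * |Torus.partialDeriv l (psiJ J s x) y| ≤ B * J.σ * J.κ ^ (-(1 / 2 : ℝ))
  int_eta_dphi : ∀ j, ∫ y, |eta J x t y| * |Torus.partialDeriv j (phiJ J s x) y| ≤
    B * J.κ ^ (-(1 / 2 : ℝ)) * ((J.σ : ℝ))⁻¹ * J.μ ^ (-(2 : ℝ))
  int_etaD_dphi : ∀ j, ∫ y, |etaD J x t y| * |Torus.partialDeriv j (phiJ J s x) y| ≤
    B * J.κ ^ (1 / 2 : ℝ) * ((J.σ : ℝ))⁻¹ * J.μ ^ (-(2 : ℝ))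
  int_etaDD_dphi : ∀ j, ∫ y, |etaDD J x t y| * |Torus.partialDeriv j (phiJ J s x) y| ≤
    B * J.κ ^ (3 / 2 : ℝ) * ((J.σ : ℝ))⁻¹ * J.μ ^ (-(2 : ℝ))
  int_etaD_ddphi : ∀ i j, ∫ y, |etaD J x t y| * |Torus.partialDeriv i (Torus.partialDeriv j (phiJ J s x)) y| ≤
    B * J.κ ^ (1 / 2 : ℝ) * J.μ⁻¹
  int_eta_ddphi : ∀ i j, ∫ y, |eta J x t y| * |Torus.partialDeriv i (Torus.partialDeriv j (phiJ J s x)) y| ≤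
    B * J.κ ^ (-(1 / 2 : ℝ)) * J.μ⁻¹
  int_sq_etaD_dphi : ∀ j, ∫ y, etaD J x t y ^ 2 * Torus.partialDeriv j (phiJ J s x) y ^ 2 ≤
    B * J.κ ^ 2 * (((J.σ : ℝ))⁻¹) ^ 2 * J.μ ^ (-(2 : ℝ))
  int_sq_eta_dphi : ∀ j, ∫ y, eta J x t y ^ 2 * Torus.partialDeriv j (phiJ J s x) y ^ 2 ≤
    B * (((J.σ : ℝ))⁻¹) ^ 2 * J.μ ^ (-(2 : ℝ))
  int_fastF_sq : ∫ y, fastF J s x t y ^ 2 ≤ B * J.κ * J.μ ^ 2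
  int_eta_etaD_psi_sq : ∫ y, |eta J x t y * etaD J x t y| * psiJ J s x y ^ 2 ≤ B * J.κ
  int_eta_sq_psi_dpsi : ∀ l, ∫ y, eta J x t y ^ 2 * |psiJ J s x y * Torus.partialDeriv l (psiJ J s x) y| ≤ B * J.σ * J.μ
  int_rpow_etaD_dphi : ∀ p : ℝ, 1 ≤ p → p ≤ 2 → ∀ j,
    ∫ y, |etaD J x t y * Torus.partialDeriv j (phiJ J s x) y| ^ p ≤
      (((J.σ : ℝ))⁻¹) ^ p * ((J.κ ^ (3 / 2 : ℝ) * B) ^ (p - 1) * (J.κ ^ (1 / 2 : ℝ) * B)) * (B * J.μ ^ (-(2 / p))) ^ p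
  int_rpow_eta_dphi : ∀ p : ℝ, 1 ≤ p → p ≤ 2 → ∀ j,
    ∫ y, |eta J x t y * Torus.partialDeriv j (phiJ J s x) y| ^ p ≤
      (((J.σ : ℝ))⁻¹) ^ p * ((J.κ ^ (1 / 2 : ℝ) * B) ^ (p - 1) * (J.κ ^ (-(1 / 2 : ℝ)) * B)) * (B * J.μ ^ (-(2 / p))) ^ p
  int_grad_invLap_fastF : ∀ l, ∫ y, |Torus.partialDeriv l (invLaplacian fun y => fastF J s x t y - 1) y| ≤ B * ((J.σ : ℝ))⁻¹

end Package

/-- Monotonicity of `ConstData` in the constants. [folklore] -/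
theorem ConstData.mono {J : Params} {x : Index 𝔡} {A C A' C' : ℝ} (hc : ConstData J x A C) (hA : A ≤ A') (hC : C ≤ C') :
    ConstData J x A' C' := by
  have hA0 : 0 ≤ A := le_trans zero_le_one hc.hA1
  have hC0 : 0 ≤ C := le_trans zero_le_one hc.hC1
  have hC'0 : 0 ≤ C' := hC0.trans hC
  have hrp : ∀ {μ e p : ℝ}, 1 ≤ μ → 0 ≤ p → (C * μ ^ e) ^ p ≤ (C' * μ ^ e) ^ p := fun {μ e p} hμ hp =>
    Real.rpow_le_rpow (mul_nonneg hC0 (Real.rpow_nonneg (by linarith) _))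
      (mul_le_mul_of_nonneg_right hC (Real.rpow_nonneg (by linarith) _)) hp
  refine ⟨hc.hA1.trans hA, fun s => (hc.hg s).trans hA, fun s => (hc.hg' s).trans hA, fun s => (hc.hg'' s).trans hA,
    hc.hIg.trans hA, hc.hIg'.trans hA, hc.hIg''.trans hA, hc.hC1.trans hC,
    fun μ hμ y => (hc.hpsi μ hμ y).trans (mul_le_mul_of_nonneg_right hC (by linarith)),
    fun μ hμ l y => (hc.hdpsi μ hμ l y).trans (mul_le_mul_of_nonneg_right hC (by positivity)),
    fun μ hμ l y => (hc.hdphi μ hμ l y).trans hC,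
    fun μ hμ i l y => (hc.hddphi μ hμ i l y).trans (mul_le_mul_of_nonneg_right hC (by linarith)),
    fun μ hμ p hp hp2 => (hc.hLpsi μ hμ p hp hp2).trans (hrp hμ (by linarith)),
    fun μ hμ p hp hp2 l => (hc.hLdpsi μ hμ p hp hp2 l).trans (hrp hμ (by linarith)),
    fun μ hμ p hp hp2 l => (hc.hLdphi μ hμ p hp hp2 l).trans (hrp hμ (by linarith)),
    fun μ hμ p hp hp2 i l => (hc.hLddphi μ hμ p hp hp2 i l).trans (hrp hμ (by linarith))⟩

/-- **Existence of the jet bounds**: for a normalised bump `g` there is one constant `B ≥ 1` such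
that for all admissible parameters with this bump, all shifts, directions and times, the bounds
`Jet.Bounds B` hold. [cite: BuckmasterVicol2020, §7.4 (7.22)–(7.24)] -/
theorem exists_bounds {g : ℝ → ℝ} (hg : Intermittent.IsBump g) :
    ∃ B : ℝ, 1 ≤ B ∧ ∀ J : Params, J.g = g → J.Valid →
      ∀ (s : Index 𝔡 → UnitAddTorus 𝔡) (x : Index 𝔡) (t : ℝ), Bounds B J s x t := by
  obtain ⟨A, hA1, hgA, hg'A, hg''A, hIgA, hIg'A, hIg''A⟩ := exists_axial_const hg
  choose Cx hCx1 hCx using fun x : Index 𝔡 => exists_transverse_const x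
  obtain ⟨K, hK⟩ := exists_eLpNorm_partialDeriv_invLaplacian_le (d := 𝔡) (p := 1) le_rfl
  set Cm : ℝ := ∑ x, Cx x with hCm
  have hCx_le : ∀ x, Cx x ≤ Cm := fun x =>
    Finset.single_le_sum (f := Cx) (fun x' _ => le_trans zero_le_one (hCx1 x')) (Finset.mem_univ x)
  have hCm1 : 1 ≤ Cm := (hCx1 (Classical.arbitrary _)).trans (hCx_le _)
  set B : ℝ := 4 * A ^ 2 * Cm ^ 2 * (1 + K) with hB
  have hA0 : 0 ≤ A := by linarith
  have hCm0 : 0 ≤ Cm := by linarith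
  have hK0 : (0 : ℝ) ≤ K := K.coe_nonneg
  -- dominations, through `P = A Cm ≥ 1`, `B = 4P²(1+K)`
  set P : ℝ := A * Cm with hPdef
  have hP1 : 1 ≤ P := by rw [hPdef]; nlinarith
  have hP0 : 0 ≤ P := by linarith
  have hBP : B = 4 * P ^ 2 * (1 + K) := by rw [hB, hPdef]; ring
  have hP2B : P ^ 2 ≤ B := by
    rw [hBP]; have : 0 ≤ P ^ 2 * K := by positivity
    nlinarith [sq_nonneg P]
  have hAC : A * Cm ≤ B := le_trans (by rw [← hPdef]; nlinarith) hP2B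
  have hA2C2 : A ^ 2 * Cm ^ 2 ≤ B := by rw [show A ^ 2 * Cm ^ 2 = P ^ 2 by rw [hPdef]; ring]; exact hP2B
  have hAP : A ≤ P := by rw [hPdef]; nlinarith
  have hCP : Cm ≤ P := by rw [hPdef]; nlinarith
  have hPP2 : P ≤ P ^ 2 := by nlinarith
  have hAle : A ≤ B := hAP.trans (hPP2.trans hP2B)
  have hCle : Cm ≤ B := hCP.trans (hPP2.trans hP2B)
  have hC2 : Cm ^ 2 ≤ B := (pow_le_pow_left₀ hCm0 hCP 2).trans hP2B
  have hA2 : A ^ 2 ≤ B := (pow_le_pow_left₀ hA0 hAP 2).trans hP2B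
  have h2K : 2 * (K : ℝ) ≤ B := by
    rw [hBP]; have : 0 ≤ (P ^ 2 - 1) * K := mul_nonneg (by nlinarith) hK0
    nlinarith [sq_nonneg P]
  have hB1 : 1 ≤ B := hAle.trans' hA1
  refine ⟨B, hB1, fun J hJg h s x t => ?_⟩
  -- the constant data for this direction
  have hc : ConstData J x A Cm := by
    have hc0 : ConstData J x A (Cx x) := by
      subst hJg
      exact ⟨hA1, hgA, hg'A, hg''A, hIgA, hIg'A, hIg''A, hCx1 x, fun μ hμ => (hCx x μ hμ).1,
        fun μ hμ => (hCx x μ hμ).2.1, fun μ hμ => (hCx x μ hμ).2.2.1, fun μ hμ => (hCx x μ hμ).2.2.2.1,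
        fun μ hμ p hp hp2 => ((hCx x μ hμ).2.2.2.2 p hp hp2).1,
        fun μ hμ p hp hp2 => ((hCx x μ hμ).2.2.2.2 p hp hp2).2.1,
        fun μ hμ p hp hp2 => ((hCx x μ hμ).2.2.2.2 p hp hp2).2.2.1,
        fun μ hμ p hp hp2 => ((hCx x μ hμ).2.2.2.2 p hp hp2).2.2.2⟩
    exact hc0.mono le_rfl (hCx_le x)
  have hcB : ConstData J x B B := hc.mono hAle hCle
  have hκ0 : 0 ≤ J.κ := by linarith [h.hκ]
  have hμ0 : 0 < J.μ := by linarith [h.hμ]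
  have hσ0 : (0 : ℝ) ≤ ((J.σ : ℝ))⁻¹ := inv_nonneg.2 (Nat.cast_nonneg _)
  have hσn : (0 : ℝ) ≤ J.σ := Nat.cast_nonneg _
  refine ⟨abs_eta_le hcB t, abs_etaD_le h hcB t, abs_etaDD_le h hcB t, abs_psiJ_le s h hcB,
    abs_partialDeriv_psiJ_le s h hcB, abs_partialDeriv_phiJ_le s h hcB, abs_partialDeriv_partialDeriv_phiJ_le s h hcB,
    ?_, ?_, fun l => ?_, fun j => ?_, fun j => ?_, fun j => ?_, fun i j => ?_, fun i j => ?_, fun j => ?_, fun j => ?_, ?_, ?_,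
    fun l => ?_, fun p hp hp2 j => integral_rpow_etaD_partialDeriv_phiJ_le s h hcB hp hp2 t j,
    fun p hp hp2 j => integral_rpow_eta_partialDeriv_phiJ_le s h hcB hp hp2 t j, fun l => ?_⟩
  · exact (integral_eta_psi_le s h hc t).trans (by gcongr)
  · exact (integral_etaD_psi_le s h hc t).trans (by gcongr)
  · exact (integral_eta_partialDeriv_psiJ_le s h hc t l).trans (by gcongr)
  · exact (integral_eta_partialDeriv_phiJ_le s h hc t j).trans (by gcongr)
  · exact (integral_etaD_partialDeriv_phiJ_le s h hc t j).trans (by gcongr)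
  · exact (integral_etaDD_partialDeriv_phiJ_le s h hc t j).trans (by gcongr)
  · exact (integral_etaD_partialDeriv_partialDeriv_phiJ_le s h hc t i j).trans (by gcongr)
  · exact (integral_eta_partialDeriv_partialDeriv_phiJ_le s h hc t i j).trans (by gcongr)
  · exact (integral_sq_etaD_partialDeriv_phiJ_le s h hc t j).trans (by gcongr)
  · exact (integral_sq_eta_partialDeriv_phiJ_le s h hc t j).trans (by gcongr)
  · exact (integral_fastF_sq_le s h hc t).trans (by gcongr)
  · exact (integral_eta_etaD_psi_sq_le s h hc t).trans (by gcongr)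
  · exact (integral_eta_sq_psi_partialDeriv_psiJ_le s h hc t l).trans (by gcongr)
  · exact (integral_abs_partialDeriv_invLaplacian_fastF_le s h hK t l).trans (by gcongr)

end Jet

end Literature.Analysis.FluidPDE
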